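import Summits.Ventures.CertifiedManyBodySolver.Theses.TcThermcert1
import Summits.Ventures.CertifiedManyBodySolver.Observables.ThermalFluxZeemanOperator
import Summits.HubbardSuperconductivity.HubbardSuperconductivity.Theorems.BalabanIRBirGappedPhaseReductionSectorFourier
import Literature.MathematicalPhysics.QuantumLattice.FreeFermionSpinTwistedTraceFormula
import Literature.MathematicalPhysics.QuantumLattice.HubbardNNNHoppingFluxThermal
import Literature.MathematicalPhysics.QuantumLattice.TwistedHoppingPlaneWaves
import HarnessLib
import Literature.Analysis.Quadrature.TrapezoidalRulePeriodic
import Literature.Analysis.Toeplitz.OneSidedSeries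
import Literature.Geometry.Riemannian.TwoConvexSchoenfliesProofs

/-! # PART A — inlined companion module `FreeGasArcInputs` (generic inputs, sorry-free; see PART B for the skeleton) -/


/-!
# PROVED second-layer inputs of the free-gas sector witness line (card `free-gas-arc-darroch`)
# for crux K1 = `TcThermcert1.ThermalStiffnessCeilingU8b10_le_1o8` (stmt-Ventures-26381)

Planner `hubbard-floor-idea-rescuer` g5 (lens = rescuer), BN-resc-5.  Companion of the checked skeleton
`Cruxes/ThermalStiffnessCeilingU8b10_le_1o8/FreeGasArcSkeleton.lean` (§3 there lists five elementary input `Prop`s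
of the analytic core `EsymmLogTwistInsensitive`).  This file is SORRY-FREE and proves:

* §A `shiftedTrapezoidShift_holds : ShiftedTrapezoidShift` — the ARC input (a real grid offset `θ/N` moves the
  `N`-point periodic trapezoidal sum of a strip-analytic `2π`-periodic function by at most `4NB/(e^{aN} − 1)`),
  from the tree's Trefethen–Weideman theorem `Literature.Analysis.Quadrature.norm_trapezoidal_sub_integral_le`
  applied to `v` and to its real translate (same strip, same bound, same period integral).
* §B–§D the DARROCH BYPASS: for positive weights the elementary symmetric functions `e_j` are log-concave in the
  two-index form `e_{i−1} e_{j+1} ≤ e_i e_j` (`1 ≤ i ≤ j`, induction on the number of weights), hence EVERY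
  degree `M ≤ n` is the mode of `j ↦ e_j t^j` for some fugacity `t > 0` (`esymm_exists_modeFugacity`), which gives
  the polynomial floor `(n+1) · e_M t^M ≥ ∏ (1 + t xᵢ)` (`prod_one_add_mul_le_card_mul_esymm`) WITHOUT Darroch's
  integer-mean theorem, Newton's inequalities or the intermediate value theorem (the skeleton's `EsymmModeAtMean`,
  `EsymmModeShare`, `IntegerMeanFugacity` are thereby not needed by the assembly).
* §E `offArcGaussianDecay_holds : OffArcGaussianDecay` — the OFF-ARC input, one line per mode.
* §G `esymmW_fourierCoeff` — the CONTOUR FORMULA `∫_{−π}^{π} e^{−iMφ} ∏ᵢ(1 + t xᵢ e^{iφ}) dφ = 2π e_M(x) t^M` at any real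
  fugacity (orthogonality `Literature.Analysis.Toeplitz.integral_exp_int_mul_I`), the starting point of the estimate.
* §H `FreeBandLogStrip` (skeleton v2 §3, verbatim) + `freeBandLogStrip_holds` — the one-line logarithm
  `Log(1 + exp(s + iφ + 2β cos z + 2β cos p₂))` is `2π`-periodic, holomorphic and bounded on the strip `|Im z| < min 1 (π/(24β))`.
* §F fugacity pinning: `(k+1) e_{k+1} ≤ (n−k)·(max weight)·e_k` and `≥ (n−k)·(min weight)·e_k`, so the mode
  fugacity of degree `M` lies in `[M/((n−M+1)·max), (M+1)/((n−M)·min)]` — for the free band this puts the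
  chemical potential inside `[−4 − O(1/β), 4 + O(1/β)]`, where a flux-independent positive fraction of the `L²`
  modes is partially occupied (the off-arc variance `∑ p(1−p) ≥ c L²`).

HONEST FRAMING: these are lemmas about symmetric functions of explicit reals and about periodic analytic functions;
nothing here touches `U = 8`.  Superconductivity in the Hubbard model is NOT proved (or disproved) by any of this.
-/

noncomputable section

open Finset Real MeasureTheory
open Literature.Geometry.Riemannian (esymm_zero_eq_one esymm_card_eq_prod esymm_nonneg_of_forall_nonneg
  esymm_eq_zero_of_card_lt esymm_cons_succ)
open scoped BigOperators

namespace Summit.Ventures.CertifiedManyBodySolver.Cruxes.ThermalStiffnessCeilingU8b10_le_1o8.FreeGasArc.Inputs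

/-! ## §A The shifted-grid trapezoid bound (the skeleton's `ShiftedTrapezoidShift`, verbatim) -/

/-- [skeleton §3, verbatim] For `v` `2π`-periodic, complex-differentiable on the open strip `|Im z| < a` and bounded
there by `B`, the `N`-point grid sum moves by at most `4 N B /(e^{aN} − 1)` under a real grid offset `θ/N`. -/
def ShiftedTrapezoidShift : Prop :=
  ∀ (v : ℂ → ℂ) (a B : ℝ), 0 < a → 0 ≤ B →
    (∀ z : ℂ, v (z + 2 * π) = v z) →
    DifferentiableOn ℂ v {z : ℂ | |z.im| < a} →
    (∀ z : ℂ, |z.im| < a → ‖v z‖ ≤ B) →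
    ∀ (N : ℕ), 0 < N → ∀ θ : ℝ,
      ‖(∑ j ∈ range N, v ((2 * π * (j : ℝ) + θ) / (N : ℝ) : ℝ)) -
          ∑ j ∈ range N, v ((2 * π * (j : ℝ)) / (N : ℝ) : ℝ)‖ ≤ 4 * N * B / (Real.exp (a * N) - 1)

/-- **The arc input holds** (two applications of Trefethen–Weideman Thm 4.2 as formalised in
`Literature.Analysis.Quadrature.norm_trapezoidal_sub_integral_le`: the trapezoidal sums of `v` and of its real
translate `z ↦ v(z + θ/N)` are both within `4πB/(e^{aN} − 1)` of the common period integral). -/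
theorem shiftedTrapezoidShift_holds : ShiftedTrapezoidShift := by
  intro v a B ha _hB hper hd hM N hN θ
  have hN0 : N ≠ 0 := hN.ne'
  have hNc : (N : ℂ) ≠ 0 := by exact_mod_cast hN0
  have hNr : (0 : ℝ) < N := by exact_mod_cast hN
  set T : ℝ := 2 * π with hT
  have hTpos : 0 < T := Real.two_pi_pos
  set c : ℝ := θ / N with hc
  -- the real translate of `v`
  set w : ℂ → ℂ := fun z => v (z + (c : ℂ)) with hw
  have hper' : ∀ z : ℂ, v (z + (T : ℂ)) = v z := fun z => by
    rw [hT]; push_cast; exact hper z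
  have hwper : ∀ z : ℂ, w (z + (T : ℂ)) = w z := by
    intro z
    simp only [hw]
    rw [add_right_comm]
    exact hper' _
  have hwd : DifferentiableOn ℂ w {z : ℂ | |z.im| < a} := by
    have h1 : DifferentiableOn ℂ (v ∘ fun z : ℂ => z + (c : ℂ)) {z : ℂ | |z.im| < a} := by
      refine hd.comp (by fun_prop) ?_
      intro z hz
      simpa using hz
    simpa [hw, Function.comp_def] using h1
  have hwM : ∀ z : ℂ, |z.im| < a → ‖w z‖ ≤ B := by
    intro z hz
    simp only [hw]
    exact hM _ (by simpa using hz)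
  have h1 := Literature.Analysis.Quadrature.norm_trapezoidal_sub_integral_le hTpos ha hd hper' hM hN0
  have h2 := Literature.Analysis.Quadrature.norm_trapezoidal_sub_integral_le hTpos ha hwd hwper hwM hN0
  -- the two period integrals agree (translation invariance of the period integral)
  have hint : ∫ x in (0:ℝ)..T, w x = ∫ x in (0:ℝ)..T, v x := by
    have e1 : (∫ x in (0:ℝ)..T, w x) = ∫ x in (0:ℝ)..T, (fun y : ℝ => v y) (x + c) := by
      apply intervalIntegral.integral_congr
      intro x _
      simp only [hw]
      push_cast
      rfl
    rw [e1, intervalIntegral.integral_comp_add_right (fun y : ℝ => v y) c]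
    have hp : Function.Periodic (fun y : ℝ => v y) T := by
      intro y
      show v ((y + T : ℝ) : ℂ) = v y
      push_cast
      exact hper' y
    have h3 := hp.intervalIntegral_add_eq c 0
    rw [zero_add] at h3
    rw [zero_add, show T + c = c + T by ring]
    exact h3
  -- subtract the two estimates
  have hden : 0 < Real.exp (a * N) - 1 := by
    have : 1 < Real.exp (a * N) := Real.one_lt_exp_iff.mpr (by positivity)
    linarith
  have e1 : Real.exp (2 * π * a * N / T) = Real.exp (a * N) := by
    congr 1
    rw [hT]
    field_simp
  rw [e1] at h1 h2
  have hsub : ‖(T / N : ℂ) * (∑ k ∈ Finset.range N, w (k * T / N) - ∑ k ∈ Finset.range N, v (k * T / N))‖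
      ≤ 2 * T * B / (Real.exp (a * N) - 1) + 2 * T * B / (Real.exp (a * N) - 1) := by
    have : (T / N : ℂ) * (∑ k ∈ Finset.range N, w (k * T / N) - ∑ k ∈ Finset.range N, v (k * T / N))
        = ((T / N : ℂ) * ∑ k ∈ Finset.range N, w (k * T / N) - ∫ x in (0:ℝ)..T, w x)
          - ((T / N : ℂ) * ∑ k ∈ Finset.range N, v (k * T / N) - ∫ x in (0:ℝ)..T, v x) := by
      rw [hint]; ring
    rw [this]
    exact (norm_sub_le _ _).trans (add_le_add h2 h1)
  -- remove the factor `T/N`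
  have hnormTN : ‖(T / N : ℂ)‖ = T / N := by
    rw [show (T / N : ℂ) = ((T / N : ℝ) : ℂ) by push_cast; rfl, Complex.norm_real]
    exact abs_of_pos (div_pos hTpos hNr)
  rw [norm_mul, hnormTN] at hsub
  have hTN : 0 < T / N := div_pos hTpos hNr
  have hsub' : ‖∑ k ∈ Finset.range N, w (k * T / N) - ∑ k ∈ Finset.range N, v (k * T / N)‖
      ≤ 4 * N * B / (Real.exp (a * N) - 1) := by
    have h4 := (le_div_iff₀' hTN).mpr hsub
    refine h4.trans_eq ?_
    field_simp
    ring
  -- identify the nodes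
  have hnode1 : ∑ k ∈ Finset.range N, w (k * T / N) = ∑ j ∈ range N, v ((2 * π * (j : ℝ) + θ) / (N : ℝ) : ℝ) := by
    refine Finset.sum_congr rfl fun k _ => ?_
    simp only [hw, hc, hT]
    congr 1
    push_cast
    field_simp
  have hnode2 : ∑ k ∈ Finset.range N, v (k * T / N) = ∑ j ∈ range N, v ((2 * π * (j : ℝ)) / (N : ℝ) : ℝ) := by
    refine Finset.sum_congr rfl fun k _ => ?_
    simp only [hT]
    congr 1
    push_cast
    ring
  rw [hnode1, hnode2] at hsub'
  exact hsub'

/-! ## §B Elementary symmetric functions of a multiset of reals: recursion, vanishing, mass identity, positivity -/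

/-- Positive weights have positive `e_k` for every `k ≤ |X|`. -/
theorem esymm_pos (X : Multiset ℝ) (hX : ∀ a ∈ X, 0 < a) {k : ℕ} (hk : k ≤ Multiset.card X) :
    0 < X.esymm k := by
  induction X using Multiset.induction generalizing k with
  | empty =>
    simp only [Multiset.card_zero, Nat.le_zero] at hk
    subst hk
    rw [esymm_zero_eq_one]
    exact one_pos
  | cons x X ih =>
    have hx : 0 < x := hX x (Multiset.mem_cons_self x X)
    have hX' : ∀ a ∈ X, 0 < a := fun a ha => hX a (Multiset.mem_cons_of_mem ha)
    rcases k with _ | k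
    · rw [esymm_zero_eq_one]
      exact one_pos
    · rw [Multiset.card_cons] at hk
      rw [esymm_cons_succ]
      have h1 : 0 < X.esymm k := ih hX' (by omega)
      have h2 : 0 ≤ X.esymm (k + 1) := esymm_nonneg_of_forall_nonneg X (fun a ha => (hX' a ha).le) _
      nlinarith [mul_pos hx h1]

/-- **Mass identity** `∑_{j ≤ |X|} e_j(X) t^j = ∏_{a ∈ X} (1 + t·a)` (the grand-canonical partition function of
one free species at fugacity `t`). -/
theorem sum_esymm_mul_pow (X : Multiset ℝ) (t : ℝ) :
    ∑ j ∈ Finset.range (Multiset.card X + 1), X.esymm j * t ^ j = (X.map fun a => 1 + t * a).prod := by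
  induction X using Multiset.induction with
  | empty => simp [esymm_zero_eq_one]
  | cons x X ih =>
    set n := Multiset.card X with hn
    set S : ℝ := ∑ j ∈ Finset.range (n + 1), X.esymm j * t ^ j with hS
    have h0 : X.esymm (n + 1) = 0 := esymm_eq_zero_of_card_lt X (by omega)
    have hS' : ∑ i ∈ Finset.range (n + 1), X.esymm (i + 1) * t ^ (i + 1) + 1 = S := by
      have h := Finset.sum_range_succ' (fun i => X.esymm i * t ^ i) (n + 1)
      rw [Finset.sum_range_succ, h0, zero_mul, add_zero, esymm_zero_eq_one, pow_zero, one_mul] at h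
      rw [hS]
      exact h.symm
    rw [Multiset.card_cons, Multiset.map_cons, Multiset.prod_cons, ← ih, Finset.sum_range_succ']
    rw [esymm_zero_eq_one, pow_zero, one_mul]
    have hterm : ∀ i ∈ Finset.range (n + 1),
        (x ::ₘ X).esymm (i + 1) * t ^ (i + 1) = X.esymm (i + 1) * t ^ (i + 1) + t * x * (X.esymm i * t ^ i) := by
      intro i _
      rw [esymm_cons_succ]
      ring
    rw [Finset.sum_congr rfl hterm, Finset.sum_add_distrib, ← Finset.mul_sum, ← hS]
    linear_combination hS'

/-! ## §C Two-index log-concavity of `e_j` for nonnegative weights -/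

/-! Two-index log-concavity of a real sequence `f` means `f(i−1) f(j+1) ≤ f(i) f(j)` for `1 ≤ i ≤ j`
(for positive sequences this is `f(k)² ≥ f(k−1) f(k+1)`, iterated); it is spelled out in each statement. -/

/-- The Viète step `g(k+1) = f(k+1) + c f(k)` (`c ≥ 0`, `g 0 = f 0`) preserves two-index log-concavity of a
nonnegative sequence. -/
theorem lc2_step {f g : ℕ → ℝ} {c : ℝ} (hf : ∀ k, 0 ≤ f k) (hc : 0 ≤ c)
    (hlc : ∀ i j : ℕ, 1 ≤ i → i ≤ j → f (i - 1) * f (j + 1) ≤ f i * f j)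
    (hg0 : g 0 = f 0) (hg : ∀ k, g (k + 1) = f (k + 1) + c * f k) :
    ∀ i j : ℕ, 1 ≤ i → i ≤ j → g (i - 1) * g (j + 1) ≤ g i * g j := by
  intro i j hi hij
  obtain ⟨j', rfl⟩ : ∃ j', j = j' + 1 := ⟨j - 1, by omega⟩
  rcases Nat.lt_or_ge i 2 with hi1 | hi2
  · -- `i = 1`
    have hi' : i = 1 := by omega
    subst hi'
    have hg1 : g 1 = f 1 + c * f 0 := hg 0
    rw [show (1 : ℕ) - 1 = 0 from rfl, hg0, hg1, hg (j' + 1), hg j']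
    have P1 : f 0 * f (j' + 1 + 1) ≤ f 1 * f (j' + 1) := by
      have h := hlc 1 (j' + 1) le_rfl (by omega)
      simpa using h
    nlinarith [mul_nonneg hc (mul_nonneg (hf 1) (hf j')), mul_nonneg (mul_nonneg hc hc) (mul_nonneg (hf 0) (hf j')),
      mul_nonneg hc (mul_nonneg (hf 0) (hf (j' + 1)))]
  · -- `i = i' + 2`
    obtain ⟨i', rfl⟩ : ∃ i', i = i' + 2 := ⟨i - 2, by omega⟩
    rw [show i' + 2 - 1 = i' + 1 by omega, hg i', hg (j' + 1), hg (i' + 1), hg j']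
    have T1 : f (i' + 1) * f (j' + 1 + 1) ≤ f (i' + 2) * f (j' + 1) := by
      have h := hlc (i' + 2) (j' + 1) (by omega) (by omega)
      simpa using h
    have T3a : f i' * f (j' + 1 + 1) ≤ f (i' + 1) * f (j' + 1) := by
      have h := hlc (i' + 1) (j' + 1) (by omega) (by omega)
      simpa using h
    have T3b : f (i' + 1) * f (j' + 1) ≤ f (i' + 2) * f j' := by
      rcases Nat.lt_or_ge (i' + 1) j' with hlt | hge
      · have h := hlc (i' + 2) j' (by omega) (by omega)
        simpa using h
      · have hj : j' = i' + 1 := by omega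
        subst hj
        simp only [mul_comm, le_refl]
    have T4 : f i' * f (j' + 1) ≤ f (i' + 1) * f j' := by
      have h := hlc (i' + 1) j' (by omega) (by omega)
      simpa using h
    have B : c * (f i' * f (j' + 1 + 1)) ≤ c * (f (i' + 2) * f j') :=
      mul_le_mul_of_nonneg_left (T3a.trans T3b) hc
    have C : c * c * (f i' * f (j' + 1)) ≤ c * c * (f (i' + 1) * f j') :=
      mul_le_mul_of_nonneg_left T4 (mul_nonneg hc hc)
    nlinarith [T1, B, C]

/-- **`e_j` of nonnegative weights is two-index log-concave** (induction on the number of weights via the Viète step;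
no Newton inequalities needed). -/
theorem esymm_lc2 (X : Multiset ℝ) (hX : ∀ a ∈ X, 0 ≤ a) :
    ∀ i j : ℕ, 1 ≤ i → i ≤ j → X.esymm (i - 1) * X.esymm (j + 1) ≤ X.esymm i * X.esymm j := by
  induction X using Multiset.induction with
  | empty =>
    intro i j _ _
    have h1 : (0 : Multiset ℝ).esymm (j + 1) = 0 := esymm_eq_zero_of_card_lt 0 (by simp)
    simp only [h1, mul_zero]
    exact mul_nonneg (esymm_nonneg_of_forall_nonneg 0 (by simp) _) (esymm_nonneg_of_forall_nonneg 0 (by simp) _)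
  | cons x X ih =>
    have hx : 0 ≤ x := hX x (Multiset.mem_cons_self x X)
    have hX' : ∀ a ∈ X, 0 ≤ a := fun a ha => hX a (Multiset.mem_cons_of_mem ha)
    exact lc2_step (f := fun k => X.esymm k) (g := fun k => (x ::ₘ X).esymm k) (fun k => esymm_nonneg_of_forall_nonneg X hX' k) hx
      (ih hX') (by simp only [esymm_zero_eq_one]) (fun k => esymm_cons_succ x X k)

/-! ## §D The mode fugacity (Darroch bypass) and the polynomial floor -/

/-- A nonnegative sequence whose ratios cross `1/t` at `M` (`f j ≤ t f(j+1)` below `M`, `t f(j+1) ≤ f j` from `M` on)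
has `j ↦ f(j) t^j` maximal at `M`. -/
theorem mode_of_ratio {f : ℕ → ℝ} {t : ℝ} {M : ℕ} (ht : 0 < t)
    (hdown : ∀ j, j < M → f j ≤ t * f (j + 1)) (hup : ∀ j, M ≤ j → t * f (j + 1) ≤ f j) :
    ∀ j, f j * t ^ j ≤ f M * t ^ M := by
  have up : ∀ d, f (M + d) * t ^ (M + d) ≤ f M * t ^ M := by
    intro d
    induction d with
    | zero => simp
    | succ d ih =>
      have h := hup (M + d) (by omega)
      calc f (M + (d + 1)) * t ^ (M + (d + 1)) = (t * f (M + d + 1)) * t ^ (M + d) := by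
            rw [show M + (d + 1) = M + d + 1 by omega, pow_succ]; ring
        _ ≤ f (M + d) * t ^ (M + d) := mul_le_mul_of_nonneg_right h (pow_nonneg ht.le _)
        _ ≤ _ := ih
  have down : ∀ d, d ≤ M → f (M - d) * t ^ (M - d) ≤ f M * t ^ M := by
    intro d
    induction d with
    | zero => intro _; simp
    | succ d ih =>
      intro hd
      have h := hdown (M - (d + 1)) (by omega)
      rw [show M - (d + 1) + 1 = M - d by omega] at h
      calc f (M - (d + 1)) * t ^ (M - (d + 1)) ≤ (t * f (M - d)) * t ^ (M - (d + 1)) :=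
            mul_le_mul_of_nonneg_right h (pow_nonneg ht.le _)
        _ = f (M - d) * t ^ (M - d) := by
            rw [show M - d = M - (d + 1) + 1 by omega, pow_succ]; ring
        _ ≤ _ := ih (by omega)
  intro j
  rcases Nat.lt_or_ge j M with h | h
  · have h' := down (M - j) (by omega)
    rwa [show M - (M - j) = j by omega] at h'
  · obtain ⟨d, rfl⟩ : ∃ d, j = M + d := ⟨j - M, by omega⟩
    exact up d

/-- **Mode fugacity (Darroch bypass).** For positive weights and EVERY degree `M ≤ |X|` there is a fugacity `t > 0`
at which `M` is the mode of `j ↦ e_j(X) t^j`.  (Darroch's theorem — integer mean ⇒ mode — is not needed: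
log-concavity alone makes every degree an exposed point of the concave sequence `log e_j`.) -/
theorem esymm_exists_modeFugacity (X : Multiset ℝ) (hX : ∀ a ∈ X, 0 < a) {M : ℕ}
    (hM : M ≤ Multiset.card X) :
    ∃ t : ℝ, 0 < t ∧ ∀ j, X.esymm j * t ^ j ≤ X.esymm M * t ^ M := by
  set n := Multiset.card X with hn
  have hpos : ∀ k, k ≤ n → 0 < X.esymm k := fun k hk => esymm_pos X hX hk
  have hlc := esymm_lc2 X (fun a ha => (hX a ha).le)
  rcases Nat.lt_or_ge M n with hMn | hMn
  · -- `M < n`: `t = e_M / e_{M+1}`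
    have hM1 : 0 < X.esymm (M + 1) := hpos (M + 1) hMn
    refine ⟨X.esymm M / X.esymm (M + 1), div_pos (hpos M hMn.le) hM1, ?_⟩
    apply mode_of_ratio (div_pos (hpos M hMn.le) hM1)
    · intro j hj
      have h := hlc (j + 1) M (by omega) (by omega)
      simp only [Nat.add_sub_cancel] at h
      rw [div_mul_eq_mul_div, le_div_iff₀ hM1]
      linarith [h]
    · intro j hj
      rcases eq_or_lt_of_le hj with rfl | hlt
      · rw [div_mul_cancel₀ _ hM1.ne']
      · have h := hlc (M + 1) j (by omega) (by omega)
        simp only [Nat.add_sub_cancel] at h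
        rw [div_mul_eq_mul_div, div_le_iff₀ hM1]
        linarith [h]
  · have hMeq : M = n := le_antisymm hM hMn
    rcases Nat.eq_zero_or_pos n with hn0 | hnpos
    · refine ⟨1, one_pos, fun j => ?_⟩
      rcases Nat.eq_zero_or_pos j with rfl | hj
      · rw [hMeq, hn0]
      · rw [esymm_eq_zero_of_card_lt X (show Multiset.card X < j by omega), zero_mul]
        exact mul_nonneg (hpos M hM).le (pow_nonneg zero_le_one _)
    · -- `M = n ≥ 1`: `t = e_{n-1} / e_n`
      have hnn : 0 < X.esymm n := hpos n le_rfl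
      refine ⟨X.esymm (n - 1) / X.esymm n, div_pos (hpos _ (by omega)) hnn, ?_⟩
      rw [hMeq]
      apply mode_of_ratio (div_pos (hpos _ (by omega)) hnn)
      · intro j hj
        rcases Nat.lt_or_ge (j + 1) n with hlt | hge
        · have h := hlc (j + 1) (n - 1) (by omega) (by omega)
          rw [Nat.add_sub_cancel, show n - 1 + 1 = n by omega] at h
          rw [div_mul_eq_mul_div, le_div_iff₀ hnn]
          linarith [h]
        · have hj' : j = n - 1 := by omega
          subst hj'
          rw [show n - 1 + 1 = n by omega, div_mul_cancel₀ _ hnn.ne']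
      · intro j hj
        rw [esymm_eq_zero_of_card_lt X (show Multiset.card X < j + 1 by omega), mul_zero]
        exact esymm_nonneg_of_forall_nonneg X (fun a ha => (hX a ha).le) j

/-- **Polynomial floor at the mode fugacity:** `∏_{a ∈ X} (1 + t a) ≤ (|X| + 1) · e_M(X) t^M`. -/
theorem prod_one_add_mul_le_of_mode (X : Multiset ℝ) {t : ℝ} {M : ℕ}
    (hmode : ∀ j, X.esymm j * t ^ j ≤ X.esymm M * t ^ M) :
    (X.map fun a => 1 + t * a).prod ≤ ((Multiset.card X : ℝ) + 1) * (X.esymm M * t ^ M) := by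
  rw [← sum_esymm_mul_pow]
  calc ∑ j ∈ Finset.range (Multiset.card X + 1), X.esymm j * t ^ j
      ≤ ∑ _j ∈ Finset.range (Multiset.card X + 1), X.esymm M * t ^ M := Finset.sum_le_sum fun j _ => hmode j
    _ = ((Multiset.card X : ℝ) + 1) * (X.esymm M * t ^ M) := by
      rw [Finset.sum_const, Finset.card_range, nsmul_eq_mul]
      push_cast
      ring

/-! ### The `Fintype`-indexed forms used by the skeleton (`esymmW`, verbatim) -/

/-- [skeleton §2, verbatim] `e_j(x) = ∑_{S ⊆ ι, |S| = j} ∏_{i ∈ S} xᵢ`. -/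
def esymmW {ι : Type} [Fintype ι] [DecidableEq ι] (x : ι → ℝ) (j : ℕ) : ℝ :=
  ∑ S ∈ (Finset.univ : Finset ι).powersetCard j, ∏ i ∈ S, x i

/-- `esymmW x j` is `Multiset.esymm` of the value multiset of `x`. -/
theorem esymmW_eq_esymm {ι : Type} [Fintype ι] [DecidableEq ι] (x : ι → ℝ) (j : ℕ) :
    esymmW x j = ((Finset.univ : Finset ι).val.map x).esymm j := by
  unfold esymmW
  exact (Finset.esymm_map_val x Finset.univ j).symm

/-- **Mode fugacity, `Fintype` form:** for positive weights `x : ι → ℝ` and every `M ≤ |ι|` there is a real `s`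
with `e_j(x) e^{s j} ≤ e_M(x) e^{s M}` for all `j`, and then `∏ᵢ (1 + e^{s} xᵢ) ≤ (|ι| + 1) e_M(x) e^{sM}`. -/
def EsymmModeFugacity : Prop :=
  ∀ (ι : Type) [Fintype ι] [DecidableEq ι] (x : ι → ℝ) (M : ℕ), (∀ i, 0 < x i) → M ≤ Fintype.card ι →
    ∃ s : ℝ, (∀ j : ℕ, esymmW x j * Real.exp (s * j) ≤ esymmW x M * Real.exp (s * M)) ∧
      (∏ i, (1 + Real.exp s * x i)) ≤ ((Fintype.card ι : ℝ) + 1) * (esymmW x M * Real.exp (s * M))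

/-- `EsymmModeFugacity` holds (Darroch bypass: log-concavity makes every degree a mode). -/
theorem esymmModeFugacity_holds : EsymmModeFugacity := by
  intro ι _ _ x M hx hM
  set X : Multiset ℝ := (Finset.univ : Finset ι).val.map x with hXdef
  have hcard : Multiset.card X = Fintype.card ι := by
    rw [hXdef, Multiset.card_map]
    rfl
  have hXpos : ∀ a ∈ X, 0 < a := by
    intro a ha
    rw [hXdef, Multiset.mem_map] at ha
    obtain ⟨i, _, rfl⟩ := ha
    exact hx i
  obtain ⟨t, ht, hmode⟩ := esymm_exists_modeFugacity X hXpos (M := M) (by rw [hcard]; exact hM)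
  refine ⟨Real.log t, ?_, ?_⟩
  · intro j
    have e1 : Real.exp (Real.log t * j) = t ^ j := by
      rw [mul_comm, Real.exp_nat_mul, Real.exp_log ht]
    have e2 : Real.exp (Real.log t * M) = t ^ M := by
      rw [mul_comm, Real.exp_nat_mul, Real.exp_log ht]
    rw [e1, e2, esymmW_eq_esymm, esymmW_eq_esymm]
    exact hmode j
  · have e2 : Real.exp (Real.log t * M) = t ^ M := by
      rw [mul_comm, Real.exp_nat_mul, Real.exp_log ht]
    rw [e2, Real.exp_log ht, esymmW_eq_esymm, ← hcard]
    have hprod : (∏ i, (1 + t * x i)) = (X.map fun a => 1 + t * a).prod := by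
      rw [hXdef, Multiset.map_map, Function.comp_def]
      exact (Finset.prod_map_val Finset.univ (fun i => 1 + t * x i)).symm
    rw [hprod]
    exact prod_one_add_mul_le_of_mode X hmode

/-! ## §E The off-arc Gaussian decay (the skeleton's `OffArcGaussianDecay`, verbatim) -/

/-- One mode: `|1 + u e^{iφ}|² = (1+u)² − 2u(1 − cos φ)` for real `u, φ`. -/
theorem normSq_one_add_mul_exp (u φ : ℝ) :
    ‖(1 : ℂ) + (u : ℂ) * Complex.exp (Complex.I * φ)‖ ^ 2 = (1 + u) ^ 2 - 2 * u * (1 - Real.cos φ) := by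
  have hre : ((1 : ℂ) + (u : ℂ) * Complex.exp (Complex.I * φ)).re = 1 + u * Real.cos φ := by
    simp [Complex.exp_re, Complex.exp_im]
  have him : ((1 : ℂ) + (u : ℂ) * Complex.exp (Complex.I * φ)).im = u * Real.sin φ := by
    simp [Complex.exp_re, Complex.exp_im]
  rw [← Complex.normSq_eq_norm_sq, Complex.normSq_apply, hre, him]
  have h := Real.sin_sq_add_cos_sq φ
  linear_combination u ^ 2 * h

/-- One mode: `|1 + u e^{iφ}| ≤ (1+u) · exp(−(1 − cos φ) u/(1+u)²)` for `u ≥ 0` (from `1 − y ≤ e^{−y}`). -/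
theorem norm_one_add_mul_exp_le (u φ : ℝ) (hu : 0 ≤ u) :
    ‖(1 : ℂ) + (u : ℂ) * Complex.exp (Complex.I * φ)‖ ≤
      (1 + u) * Real.exp (-((1 - Real.cos φ) * (u / (1 + u) ^ 2))) := by
  have h1u : 0 < 1 + u := by linarith
  set y : ℝ := (1 - Real.cos φ) * (u / (1 + u) ^ 2) with hy
  have hsq := normSq_one_add_mul_exp u φ
  have hkey : ‖(1 : ℂ) + (u : ℂ) * Complex.exp (Complex.I * φ)‖ ^ 2 ≤ ((1 + u) * Real.exp (-y)) ^ 2 := by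
    rw [hsq, mul_pow, ← Real.exp_nat_mul]
    have hexp : -(2 * y) + 1 ≤ Real.exp (-(2 * y)) := Real.add_one_le_exp _
    have e2 : ((2 : ℕ) : ℝ) * -y = -(2 * y) := by push_cast; ring
    rw [e2]
    have hid : (1 + u) ^ 2 * (-(2 * y) + 1) = (1 + u) ^ 2 - 2 * u * (1 - Real.cos φ) := by
      rw [hy]
      field_simp
      ring
    calc (1 + u) ^ 2 - 2 * u * (1 - Real.cos φ) = (1 + u) ^ 2 * (-(2 * y) + 1) := hid.symm
      _ ≤ (1 + u) ^ 2 * Real.exp (-(2 * y)) := mul_le_mul_of_nonneg_left hexp (by positivity)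
  exact le_of_pow_le_pow_left₀ two_ne_zero (by positivity) hkey

/-- [skeleton §3, verbatim] Off the arc the twisted product is Gaussian-small relative to the untwisted one. -/
def OffArcGaussianDecay : Prop :=
  ∀ (ι : Type) [Fintype ι] (u : ι → ℝ) (φ : ℝ), (∀ i, 0 < u i) →
    ‖∏ i, ((1 : ℂ) + (u i : ℂ) * Complex.exp (Complex.I * φ))‖ ≤
      (∏ i, (1 + u i)) * Real.exp (-((1 - Real.cos φ) * ∑ i, u i / (1 + u i) ^ 2))

/-- **The off-arc input holds.** -/
theorem offArcGaussianDecay_holds : OffArcGaussianDecay := by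
  intro ι _ u φ hu
  calc ‖∏ i, ((1 : ℂ) + (u i : ℂ) * Complex.exp (Complex.I * φ))‖
      = ∏ i, ‖(1 : ℂ) + (u i : ℂ) * Complex.exp (Complex.I * φ)‖ := norm_prod _ _
    _ ≤ ∏ i, ((1 + u i) * Real.exp (-((1 - Real.cos φ) * (u i / (1 + u i) ^ 2)))) :=
        Finset.prod_le_prod (fun i _ => norm_nonneg _) (fun i _ => norm_one_add_mul_exp_le (u i) φ (hu i).le)
    _ = (∏ i, (1 + u i)) * Real.exp (-((1 - Real.cos φ) * ∑ i, u i / (1 + u i) ^ 2)) := by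
        rw [Finset.prod_mul_distrib, ← Real.exp_sum, Finset.mul_sum, ← Finset.sum_neg_distrib]

/-! ## §F Fugacity pinning: ratio bounds `(n−k)·min·e_k ≤ (k+1)·e_{k+1} ≤ (n−k)·max·e_k` -/

/-- Upper ratio bound: if every weight is `≤ B`, then `(k+1) e_{k+1}(X) ≤ (|X| − k) B e_k(X)` (all `k`; for
`k ≥ |X|` both sides vanish or the right side is `≤ 0 = ` left side). -/
theorem succ_mul_esymm_succ_le (X : Multiset ℝ) {B : ℝ} (hX : ∀ a ∈ X, 0 ≤ a) (hB : ∀ a ∈ X, a ≤ B) :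
    ∀ k : ℕ, ((k : ℝ) + 1) * X.esymm (k + 1) ≤ ((Multiset.card X : ℝ) - k) * B * X.esymm k := by
  induction X using Multiset.induction with
  | empty =>
    intro k
    rw [esymm_eq_zero_of_card_lt 0 (by simp)]
    rcases Nat.eq_zero_or_pos k with rfl | hk
    · simp [esymm_zero_eq_one]
    · rw [esymm_eq_zero_of_card_lt 0 (by simpa using hk)]
      simp
  | cons x X ih =>
    intro k
    have hx : 0 ≤ x := hX x (Multiset.mem_cons_self x X)
    have hxB : x ≤ B := hB x (Multiset.mem_cons_self x X)
    have hX' : ∀ a ∈ X, 0 ≤ a := fun a ha => hX a (Multiset.mem_cons_of_mem ha)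
    have hB' : ∀ a ∈ X, a ≤ B := fun a ha => hB a (Multiset.mem_cons_of_mem ha)
    have hB0 : 0 ≤ B := hx.trans hxB
    rw [Multiset.card_cons, esymm_cons_succ]
    push_cast
    rcases k with _ | k
    · -- `k = 0`: `e_1(x ∷ X) = e_1(X) + x ≤ (n+1) B`
      have h := ih hX' hB' 0
      simp only [zero_add, one_mul, sub_zero, CharP.cast_eq_zero] at h ⊢
      rw [esymm_zero_eq_one] at h
      rw [esymm_zero_eq_one, esymm_zero_eq_one]
      nlinarith [h]
    · rw [esymm_cons_succ]
      have h1 := ih hX' hB' (k + 1)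
      have h0 := ih hX' hB' k
      have hek : 0 ≤ X.esymm k := esymm_nonneg_of_forall_nonneg X hX' k
      have hek1 : 0 ≤ X.esymm (k + 1) := esymm_nonneg_of_forall_nonneg X hX' (k + 1)
      push_cast at h1 h0 ⊢
      -- `(k+2) (e_{k+2} + x e_{k+1}) ≤ (n+1-(k+1)) B (e_{k+1} + x e_k)`:
      -- `(k+2) e_{k+2} ≤ (n-k-1) B e_{k+1}` (h1), `x (k+2) e_{k+1} = x[(k+1) e_{k+1} + e_{k+1}] ≤ x (n-k) B e_k + x e_{k+1}`
      -- (h0), and `x e_{k+1} ≤ B e_{k+1}`.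
      nlinarith [mul_le_mul_of_nonneg_left h0 hx, mul_le_mul_of_nonneg_right hxB hek1]

/-- Lower ratio bound: if every weight is `≥ b` (`b ≥ 0`), then `(|X| − k) b e_k(X) ≤ (k+1) e_{k+1}(X)`. -/
theorem sub_mul_esymm_le_succ_mul_esymm_succ (X : Multiset ℝ) {b : ℝ} (hb : 0 ≤ b) (hX : ∀ a ∈ X, b ≤ a) :
    ∀ k : ℕ, ((Multiset.card X : ℝ) - k) * b * X.esymm k ≤ ((k : ℝ) + 1) * X.esymm (k + 1) := by
  induction X using Multiset.induction with
  | empty =>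
    intro k
    rw [esymm_eq_zero_of_card_lt 0 (by simp : Multiset.card (0 : Multiset ℝ) < k + 1)]
    rcases Nat.eq_zero_or_pos k with rfl | hk
    · simp [esymm_zero_eq_one]
    · rw [esymm_eq_zero_of_card_lt 0 (by simpa using hk)]
      simp
  | cons x X ih =>
    intro k
    have hxb : b ≤ x := hX x (Multiset.mem_cons_self x X)
    have hx : 0 ≤ x := hb.trans hxb
    have hX' : ∀ a ∈ X, b ≤ a := fun a ha => hX a (Multiset.mem_cons_of_mem ha)
    have hX0' : ∀ a ∈ X, 0 ≤ a := fun a ha => hb.trans (hX' a ha)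
    have ih' := ih hX'
    rw [Multiset.card_cons, esymm_cons_succ]
    push_cast
    rcases k with _ | k
    · have h := ih' 0
      simp only [zero_add, one_mul, sub_zero, CharP.cast_eq_zero] at h ⊢
      rw [esymm_zero_eq_one] at h
      rw [esymm_zero_eq_one, esymm_zero_eq_one]
      nlinarith [h]
    · rw [esymm_cons_succ]
      have h1 := ih' (k + 1)
      have h0 := ih' k
      have hek : 0 ≤ X.esymm k := esymm_nonneg_of_forall_nonneg X hX0' k
      have hek1 : 0 ≤ X.esymm (k + 1) := esymm_nonneg_of_forall_nonneg X hX0' (k + 1)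
      push_cast at h1 h0 ⊢
      nlinarith [mul_le_mul_of_nonneg_left h0 hx, mul_le_mul_of_nonneg_right hxb hek1]

/-- **Fugacity pinning at a mode.** If `t > 0` makes `M` the mode of `j ↦ e_j(X) t^j` (positive weights in
`[b, B]`, `M < |X|`), then `(|X| − M)·b·t ≤ M + 1` and, if moreover `1 ≤ M`, `M ≤ (|X| − M + 1)·B·t`:
the fugacity is comparable to `M / (|X| − M)` within the factor `B/b` — for Boltzmann weights `e^{−βξ}`,
`|ξ| ≤ 4`, the chemical potential `β⁻¹ log t` lies in `[−4 − O(β⁻¹), 4 + O(β⁻¹)]` at any fixed filling fraction. -/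
theorem modeFugacity_pinned (X : Multiset ℝ) {b B t : ℝ} {M : ℕ} (hb : 0 < b) (hXb : ∀ a ∈ X, b ≤ a)
    (hXB : ∀ a ∈ X, a ≤ B) (ht : 0 < t) (hM : M < Multiset.card X)
    (hmode : ∀ j, X.esymm j * t ^ j ≤ X.esymm M * t ^ M) :
    ((Multiset.card X : ℝ) - M) * b * t ≤ (M : ℝ) + 1 ∧
      (1 ≤ M → (M : ℝ) ≤ ((Multiset.card X : ℝ) - M + 1) * B * t) := by
  have hX0 : ∀ a ∈ X, 0 ≤ a := fun a ha => hb.le.trans (hXb a ha)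
  have hXpos : ∀ a ∈ X, 0 < a := fun a ha => hb.trans_le (hXb a ha)
  have heM : 0 < X.esymm M := esymm_pos X hXpos hM.le
  constructor
  · -- from `e_{M+1} t^{M+1} ≤ e_M t^M`, i.e. `t e_{M+1} ≤ e_M`, and `(n−M) b e_M ≤ (M+1) e_{M+1}`
    have h1 := hmode (M + 1)
    rw [pow_succ] at h1
    have h1' : X.esymm (M + 1) * t ≤ X.esymm M := by
      have := h1
      have htM : 0 < t ^ M := pow_pos ht M
      nlinarith [this]
    have h2 := sub_mul_esymm_le_succ_mul_esymm_succ X hb.le hXb M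
    -- `(n−M) b t e_M ≤ (M+1) t e_{M+1} ≤ (M+1) e_M`
    have h3 : ((Multiset.card X : ℝ) - M) * b * t * X.esymm M ≤ ((M : ℝ) + 1) * X.esymm M := by
      nlinarith [mul_le_mul_of_nonneg_left h2 ht.le, mul_le_mul_of_nonneg_left h1' (by positivity : (0:ℝ) ≤ (M:ℝ) + 1)]
    exact le_of_mul_le_mul_right h3 heM
  · intro hM1
    -- from `e_{M−1} t^{M−1} ≤ e_M t^M`, i.e. `e_{M−1} ≤ t e_M`, and `M e_M ≤ (n−M+1) B e_{M−1}`
    obtain ⟨M', rfl⟩ : ∃ M', M = M' + 1 := ⟨M - 1, by omega⟩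
    have h1 := hmode M'
    rw [pow_succ] at h1
    have h1' : X.esymm M' ≤ X.esymm (M' + 1) * t := by
      have htM : 0 < t ^ M' := pow_pos ht M'
      nlinarith [h1]
    have h2 := succ_mul_esymm_succ_le X hX0 hXB M'
    have hB0 : 0 ≤ B := by
      obtain ⟨a, ha⟩ := Multiset.card_pos_iff_exists_mem.mp (by omega : 0 < Multiset.card X)
      exact (hX0 a ha).trans (hXB a ha)
    push_cast
    have hnM : (0:ℝ) ≤ (Multiset.card X : ℝ) - M' := by
      have : (M' : ℝ) + 1 < Multiset.card X := by exact_mod_cast hM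
      linarith
    have h3 : ((M' : ℝ) + 1) * X.esymm (M' + 1) ≤ ((Multiset.card X : ℝ) - (M' + 1) + 1) * B * t * X.esymm (M' + 1) := by
      have h4 := mul_le_mul_of_nonneg_left h1' (mul_nonneg hnM hB0)
      have hcast : ((Multiset.card X : ℝ) - (M' + 1) + 1) = (Multiset.card X : ℝ) - M' := by ring
      rw [hcast]
      nlinarith [h2, h4]
    exact le_of_mul_le_mul_right h3 heM

/-! ## §G The contour formula: `e_M(x) t^M` is the `M`-th Fourier coefficient of `φ ↦ ∏ᵢ (1 + t e^{iφ} xᵢ)` -/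

/-- **Coefficient extraction (any real fugacity `t`).**
`∫_{−π}^{π} e^{−iMφ} ∏ᵢ (1 + t xᵢ e^{iφ}) dφ = 2π · e_M(x) t^M` — the starting point of the arc/off-arc estimate
(orthogonality `Literature.Analysis.Toeplitz.integral_exp_int_mul_I` after expanding the product over subsets). -/
theorem esymmW_fourierCoeff {ι : Type} [Fintype ι] [DecidableEq ι] (x : ι → ℝ) (t : ℝ) (M : ℕ) :
    ∫ φ in (-π)..π, Complex.exp (-((M : ℂ) * φ * Complex.I)) *
        ∏ i, ((1 : ℂ) + ((t * x i : ℝ) : ℂ) * Complex.exp (φ * Complex.I))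
      = 2 * π * ((esymmW x M * t ^ M : ℝ) : ℂ) := by
  -- expand the product over subsets
  have hexp : ∀ φ : ℝ, ∏ i, ((1 : ℂ) + ((t * x i : ℝ) : ℂ) * Complex.exp (φ * Complex.I))
      = ∑ S ∈ (Finset.univ : Finset ι).powerset,
          ((t : ℂ) * Complex.exp (φ * Complex.I)) ^ S.card * ∏ i ∈ S, (x i : ℂ) := by
    intro φ
    rw [Finset.prod_one_add]
    refine Finset.sum_congr rfl fun S _ => ?_
    rw [← Finset.prod_const, ← Finset.prod_mul_distrib]
    refine Finset.prod_congr rfl fun i _ => ?_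
    push_cast
    ring
  simp_rw [hexp, Finset.mul_sum]
  -- each term is a constant times `e^{i(|S| − M)φ}`
  have hterm_fun : ∀ S : Finset ι, (fun φ : ℝ => Complex.exp (-((M : ℂ) * φ * Complex.I)) *
      (((t : ℂ) * Complex.exp (φ * Complex.I)) ^ S.card * ∏ i ∈ S, (x i : ℂ)))
      = fun φ : ℝ => ((t : ℂ) ^ S.card * ∏ i ∈ S, (x i : ℂ)) *
          Complex.exp ((((S.card : ℤ) - M : ℤ) : ℂ) * φ * Complex.I) := by
    intro S
    funext φ
    rw [mul_pow, ← Complex.exp_nat_mul]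
    have h2 : Complex.exp (-((M : ℂ) * φ * Complex.I)) * Complex.exp ((S.card : ℕ) * (φ * Complex.I))
        = Complex.exp ((((S.card : ℤ) - M : ℤ) : ℂ) * φ * Complex.I) := by
      rw [← Complex.exp_add]
      congr 1
      push_cast
      ring
    calc Complex.exp (-((M : ℂ) * φ * Complex.I)) *
          ((t : ℂ) ^ S.card * Complex.exp ((S.card : ℕ) * (φ * Complex.I)) * ∏ i ∈ S, (x i : ℂ))
        = (Complex.exp (-((M : ℂ) * φ * Complex.I)) * Complex.exp ((S.card : ℕ) * (φ * Complex.I))) *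
            ((t : ℂ) ^ S.card * ∏ i ∈ S, (x i : ℂ)) := by ring
      _ = _ := by rw [h2]; ring
  have hint : ∀ S ∈ (Finset.univ : Finset ι).powerset, IntervalIntegrable (fun φ : ℝ =>
      Complex.exp (-((M : ℂ) * φ * Complex.I)) *
        (((t : ℂ) * Complex.exp (φ * Complex.I)) ^ S.card * ∏ i ∈ S, (x i : ℂ))) MeasureTheory.volume (-π) π := by
    intro S _
    exact (Continuous.intervalIntegrable (by fun_prop) _ _)
  rw [intervalIntegral.integral_finsetSum hint]
  have hterm : ∀ S : Finset ι, ∫ φ in (-π)..π, Complex.exp (-((M : ℂ) * φ * Complex.I)) *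
      (((t : ℂ) * Complex.exp (φ * Complex.I)) ^ S.card * ∏ i ∈ S, (x i : ℂ))
      = if S.card = M then ((t : ℂ) ^ S.card * ∏ i ∈ S, (x i : ℂ)) * (2 * π) else 0 := by
    intro S
    rw [hterm_fun S, intervalIntegral.integral_const_mul, Literature.Analysis.Toeplitz.integral_exp_int_mul_I]
    by_cases h : S.card = M
    · rw [if_pos (by omega : ((S.card : ℤ) - M : ℤ) = 0), if_pos h]
    · rw [if_neg (by omega : ¬ ((S.card : ℤ) - M : ℤ) = 0), if_neg h, mul_zero]
  rw [Finset.sum_congr rfl (fun S _ => hterm S), ← Finset.sum_filter, ← Finset.powersetCard_eq_filter]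
  -- on `powersetCard M`, `|S| = M`
  rw [Finset.sum_congr rfl (fun S hS => by rw [(Finset.mem_powersetCard.1 hS).2]), ← Finset.sum_mul,
    ← Finset.mul_sum]
  unfold esymmW
  push_cast
  ring

/-! ## §H The one-line logarithm is strip-analytic (the skeleton v2's `FreeBandLogStrip`, verbatim) -/

/-- `|sinh y| ≤ 2|y|` for `|y| ≤ 1`. -/
theorem abs_sinh_le_two_mul_abs {y : ℝ} (hy : |y| ≤ 1) : |Real.sinh y| ≤ 2 * |y| := by
  rw [Real.sinh_eq]
  have h1 := Real.abs_exp_sub_one_le hy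
  have h2 := Real.abs_exp_sub_one_le (x := -y) (by rwa [abs_neg])
  rw [abs_neg] at h2
  have : Real.exp y - Real.exp (-y) = (Real.exp y - 1) - (Real.exp (-y) - 1) := by ring
  rw [this, abs_div, abs_two]
  calc |(Real.exp y - 1) - (Real.exp (-y) - 1)| / 2
      ≤ (|Real.exp y - 1| + |Real.exp (-y) - 1|) / 2 := by gcongr; exact abs_sub _ _
    _ ≤ (2 * |y| + 2 * |y|) / 2 := by gcongr
    _ = 2 * |y| := by ring

/-- `cosh y ≤ 3` for `|y| ≤ 1`. -/
theorem cosh_le_three {y : ℝ} (hy : |y| ≤ 1) : Real.cosh y ≤ 3 := by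
  rw [Real.cosh_eq]
  have h1 := (abs_le.1 (Real.abs_exp_sub_one_le hy)).2
  have h2 := (abs_le.1 (Real.abs_exp_sub_one_le (x := -y) (by rwa [abs_neg]))).2
  rw [abs_neg] at h2
  linarith

/-- [skeleton v2 §3, verbatim] For `β > 0` there are a strip half-width `a > 0` and a bound `B` such that for every
log-fugacity `s ∈ [−4β − 1, 4β + 1]`, every arc angle `|φ| ≤ π/2` and every transverse momentum `p₂`, the one-line logarithm
`v(z) = Log(1 + exp(s + iφ + 2β cos z + 2β cos p₂))` is `2π`-periodic, complex-differentiable on `|Im z| < a`, bounded by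
`B` there, and exponentiates back to the factor on the real line. -/
def FreeBandLogStrip : Prop :=
  ∀ β : ℝ, 0 < β → ∃ a : ℝ, 0 < a ∧ ∃ B : ℝ, 0 ≤ B ∧
    ∀ s : ℝ, -4 * β - 1 ≤ s → s ≤ 4 * β + 1 → ∀ φ : ℝ, |φ| ≤ π / 2 → ∀ p₂ : ℝ,
      let v : ℂ → ℂ := fun z =>
        Complex.log (1 + Complex.exp ((s : ℂ) + (φ : ℂ) * Complex.I + 2 * β * Complex.cos z + 2 * β * Real.cos p₂))
      (∀ z : ℂ, v (z + 2 * π) = v z) ∧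
      DifferentiableOn ℂ v {z : ℂ | |z.im| < a} ∧
      (∀ z : ℂ, |z.im| < a → ‖v z‖ ≤ B) ∧
      (∀ p₁ : ℝ, Complex.exp (v p₁) =
        1 + Complex.exp ((s : ℂ) + (φ : ℂ) * Complex.I + 2 * β * Real.cos p₁ + 2 * β * Real.cos p₂))

/-- **The strip input holds**, with `a = min 1 (π/(24β))` and `B = e^{12β+1} + 1 + π`: on the strip the exponent has
imaginary part in `[−2π/3, 2π/3]` (`|φ| ≤ π/2`, `|Im(2β cos z)| ≤ 4βa ≤ π/6`), so `w = e^{g}` has `Re w ≥ −‖w‖/2`,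
`1 + w` lies in the slit plane with `‖1 + w‖ ≥ 1/2`, and `‖w‖ ≤ e^{12β+1}`. -/
theorem freeBandLogStrip_holds : FreeBandLogStrip := by
  intro β hβ
  have ha_pos : 0 < min 1 (π / (24 * β)) := lt_min one_pos (by positivity)
  have ha1 : min 1 (π / (24 * β)) ≤ 1 := min_le_left _ _
  have ha2 : 4 * β * min 1 (π / (24 * β)) ≤ π / 6 := by
    calc 4 * β * min 1 (π / (24 * β)) ≤ 4 * β * (π / (24 * β)) := by gcongr; exact min_le_right _ _
      _ = π / 6 := by field_simp; ring
  refine ⟨min 1 (π / (24 * β)), ha_pos, Real.exp (12 * β + 1) + 1 + π, by positivity, ?_⟩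
  intro s hs1 hs2 φ hφ p₂
  dsimp only
  -- the exponent
  set g : ℂ → ℂ := fun z =>
    (s : ℂ) + (φ : ℂ) * Complex.I + 2 * β * Complex.cos z + 2 * β * Real.cos p₂ with hg
  have hgz : ∀ z : ℂ, (s : ℂ) + (φ : ℂ) * Complex.I + 2 * β * Complex.cos z + 2 * β * Real.cos p₂ = g z :=
    fun z => rfl
  simp_rw [hgz]
  -- real and imaginary parts of `cos z` (kept local: the tree has these as lemmas in unrelated modules)
  have cos_re_eq : ∀ z : ℂ, (Complex.cos z).re = Real.cos z.re * Real.cosh z.im := fun z => by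
    rw [Complex.cos_eq]; simp [Complex.cos_ofReal_re, Complex.cosh_ofReal_re]
  have cos_im_eq : ∀ z : ℂ, (Complex.cos z).im = -(Real.sin z.re * Real.sinh z.im) := fun z => by
    rw [Complex.cos_eq]; simp [Complex.sin_ofReal_re, Complex.sinh_ofReal_re]
  -- key facts on the strip
  have key : ∀ z : ℂ, |z.im| < min 1 (π / (24 * β)) →
      (1 + Complex.exp (g z)) ∈ Complex.slitPlane ∧ 1 / 2 ≤ ‖1 + Complex.exp (g z)‖ ∧
        ‖Complex.exp (g z)‖ ≤ Real.exp (12 * β + 1) := by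
    intro z hz
    have hy1 : |z.im| ≤ 1 := hz.le.trans ha1
    have hgim : (g z).im = φ - 2 * β * (Real.sin z.re * Real.sinh z.im) := by
      simp [hg, cos_im_eq]; ring
    have hgre : (g z).re = s + 2 * β * (Real.cos z.re * Real.cosh z.im) + 2 * β * Real.cos p₂ := by
      simp [hg, cos_re_eq]
    have hsinh : |Real.sinh z.im| ≤ 2 * |z.im| := abs_sinh_le_two_mul_abs hy1
    have hss : |Real.sin z.re * Real.sinh z.im| ≤ 2 * min 1 (π / (24 * β)) := by
      rw [abs_mul]
      calc |Real.sin z.re| * |Real.sinh z.im| ≤ 1 * (2 * |z.im|) := by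
            gcongr
            · exact Real.abs_sin_le_one _
        _ ≤ 2 * min 1 (π / (24 * β)) := by linarith [hz.le]
    have hψ : |(g z).im| ≤ π / 2 + π / 6 := by
      rw [hgim]
      have h2 : |2 * β * (Real.sin z.re * Real.sinh z.im)| ≤ 4 * β * min 1 (π / (24 * β)) := by
        rw [abs_mul, abs_of_pos (by positivity : (0:ℝ) < 2 * β)]
        nlinarith [hss, hβ]
      calc |φ - 2 * β * (Real.sin z.re * Real.sinh z.im)|
          ≤ |φ| + |2 * β * (Real.sin z.re * Real.sinh z.im)| := abs_sub _ _
        _ ≤ π / 2 + π / 6 := by linarith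
    have hcos : -(1 / 2 : ℝ) ≤ Real.cos (g z).im := by
      rw [← Real.cos_abs]
      have hle : |(g z).im| ≤ π / 6 + π / 2 := by linarith
      have := Real.cos_le_cos_of_nonneg_of_le_pi (abs_nonneg _) (by linarith [Real.pi_pos]) hle
      rw [Real.cos_add_pi_div_two, Real.sin_pi_div_six] at this
      linarith
    have hρpos : 0 < Real.exp (g z).re := Real.exp_pos _
    have hw_re : (Complex.exp (g z)).re = Real.exp (g z).re * Real.cos (g z).im := Complex.exp_re _
    have hw_im : (Complex.exp (g z)).im = Real.exp (g z).re * Real.sin (g z).im := Complex.exp_im _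
    have hw_norm : ‖Complex.exp (g z)‖ = Real.exp (g z).re := Complex.norm_exp _
    refine ⟨?_, ?_, ?_⟩
    · rw [Complex.mem_slitPlane_iff]
      by_cases hsin : Real.sin (g z).im = 0
      · left
        have hlt1 : -π < (g z).im := by have := (abs_le.1 hψ).1; linarith [Real.pi_pos]
        have hlt2 : (g z).im < π := by have := (abs_le.1 hψ).2; linarith [Real.pi_pos]
        have h0 : (g z).im = 0 := (Real.sin_eq_zero_iff_of_lt_of_lt hlt1 hlt2).1 hsin
        rw [Complex.add_re, Complex.one_re, hw_re, h0, Real.cos_zero, mul_one]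
        linarith
      · right
        rw [Complex.add_im, Complex.one_im, hw_im, zero_add]
        exact mul_ne_zero hρpos.ne' hsin
    · have hsq : (3 : ℝ) / 4 ≤ ‖1 + Complex.exp (g z)‖ ^ 2 := by
        rw [Complex.sq_norm, Complex.normSq_apply, Complex.add_re, Complex.add_im, Complex.one_re, Complex.one_im,
          hw_re, hw_im, zero_add]
        have hsc : Real.sin (g z).im ^ 2 + Real.cos (g z).im ^ 2 = 1 := Real.sin_sq_add_cos_sq _
        nlinarith [hcos, hρpos, hsc, sq_nonneg (Real.exp (g z).re - 1 / 2)]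
      nlinarith [norm_nonneg (1 + Complex.exp (g z)), hsq]
    · rw [hw_norm]
      apply Real.exp_le_exp.2
      rw [hgre]
      have hcosh : Real.cosh z.im ≤ 3 := cosh_le_three hy1
      have h1 : Real.cos z.re * Real.cosh z.im ≤ 3 := by
        calc Real.cos z.re * Real.cosh z.im ≤ |Real.cos z.re * Real.cosh z.im| := le_abs_self _
          _ = |Real.cos z.re| * Real.cosh z.im := by rw [abs_mul, abs_of_pos (Real.cosh_pos _)]
          _ ≤ 1 * 3 := by
              gcongr
              · exact Real.abs_cos_le_one _
          _ = 3 := one_mul _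
      have h2 : Real.cos p₂ ≤ 1 := Real.cos_le_one _
      nlinarith [hβ, h1, h2, hs2]
  refine ⟨?_, ?_, ?_, ?_⟩
  · -- periodicity
    intro z
    simp only [hg, Complex.cos_add_two_pi]
  · -- differentiability on the strip
    intro z hz
    have hz' : |z.im| < min 1 (π / (24 * β)) := hz
    apply DifferentiableAt.differentiableWithinAt
    have hd : DifferentiableAt ℂ (fun z => 1 + Complex.exp (g z)) z := by
      simp only [hg]
      fun_prop
    exact hd.clog (key z hz').1
  · -- the bound
    intro z hz
    obtain ⟨hslit, hlow, hup⟩ := key z hz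
    have hne : 1 + Complex.exp (g z) ≠ 0 := Complex.slitPlane_ne_zero hslit
    have hpos : 0 < ‖1 + Complex.exp (g z)‖ := norm_pos_iff.2 hne
    have hre : |(Complex.log (1 + Complex.exp (g z))).re| ≤ Real.exp (12 * β + 1) + 1 := by
      rw [Complex.log_re, abs_le]
      constructor
      · -- lower: log x = -log x⁻¹ ≥ -(x⁻¹ - 1) ≥ -1
        have hinv : Real.log (‖1 + Complex.exp (g z)‖)⁻¹ ≤ (‖1 + Complex.exp (g z)‖)⁻¹ - 1 :=
          Real.log_le_sub_one_of_pos (inv_pos.2 hpos)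
        rw [Real.log_inv] at hinv
        have hinv2 : (‖1 + Complex.exp (g z)‖)⁻¹ ≤ 2 := by
          rw [inv_le_comm₀ hpos (by norm_num)]; linarith
        linarith [Real.exp_pos (12 * β + 1)]
      · have h1 : Real.log ‖1 + Complex.exp (g z)‖ ≤ ‖1 + Complex.exp (g z)‖ - 1 := Real.log_le_sub_one_of_pos hpos
        have h2 : ‖1 + Complex.exp (g z)‖ ≤ 1 + ‖Complex.exp (g z)‖ := by
          calc ‖1 + Complex.exp (g z)‖ ≤ ‖(1 : ℂ)‖ + ‖Complex.exp (g z)‖ := norm_add_le _ _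
            _ = 1 + ‖Complex.exp (g z)‖ := by rw [norm_one]
        linarith
    have him : |(Complex.log (1 + Complex.exp (g z))).im| ≤ π := by
      rw [Complex.log_im]; exact Complex.abs_arg_le_pi _
    calc ‖Complex.log (1 + Complex.exp (g z))‖
        ≤ |(Complex.log (1 + Complex.exp (g z))).re| + |(Complex.log (1 + Complex.exp (g z))).im| :=
          Complex.norm_le_abs_re_add_abs_im _
      _ ≤ Real.exp (12 * β + 1) + 1 + π := by linarith
  · -- exponentiating back on the real line
    intro p₁
    have h0 : |((p₁ : ℂ)).im| < min 1 (π / (24 * β)) := by simpa using ha_pos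
    rw [Complex.exp_log (Complex.slitPlane_ne_zero (key p₁ h0).1)]
    simp only [hg, Complex.ofReal_cos]

end Summit.Ventures.CertifiedManyBodySolver.Cruxes.ThermalStiffnessCeilingU8b10_le_1o8.FreeGasArc.Inputs

end



/-!
BUILD NOTE (v4.2): this tree copy is SELF-CONTAINED — PART A below inlines `Cruxes/…/FreeGasArcInputs.lean` (tree d3c3c585d14e,
sorry-free; here lint-cleaned: five folklore `esymm` lemmas cited from `Literature.Geometry.Riemannian`, `cos` re/im lemmas inlined)
under the namespace `…FreeGasArc.Inputs`, because the Lean farm does not build crux workfiles for import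
(`lean check` of the importing form answers `remote:stale:unbuilt:…FreeGasArcInputs`); the importing form (identical PART B with
`import …FreeGasArcInputs`) is kept at `run/shared/lean/pub/hubbard-floor/hubbard-floor-idea-rescuer/FreeGasArcSkeleton.v4.lean`.
PART B (the skeleton proper) starts at the second module docstring. LANDED FORM (same content, gate-accepted, ≤ 400-line modules,
namespace `Summit.Ventures.CertifiedManyBodySolver.Theorems.FreeGasArc(.Inputs)`): `Theorems/TcThermcert1FreeGas{Defs,TwistedTrace,SectorLogZ,
AnalyticInputs,EsymmInputs,PinningInputs,WitnessProps,ArcEstimate,Assembly}.lean` (proposals p682359 p682766 p683094 p683092 p683598 p683749 p683824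
p684367 …, all `--supports stmt-Ventures-26381 --as helper`; `TcThermcert1FreeGasSectorLogZ` = hubbard-floor target ST-K1-U0-1).

# Prover-ready CHECKED SKELETON of the free-gas sector witness (card `free-gas-arc-darroch`, crit-1 KEEP 2026-08-28)
# for crux K1 = `TcThermcert1.ThermalStiffnessCeilingU8b10_le_1o8` (stmt-Ventures-26381) — its `U = 0` twin with constant `0`

Planner `hubbard-floor-idea-rescuer` g1 (lens = rescuer). This is NOT a concluding line for K1 (nothing here reaches
`U = 8`; the file is published as a crux workfile, not under `Lines/`). It turns the KEEP card into two NAMED stubs with a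
KERNEL-CHECKED composition down to the rung `ObsThermalStiffnessSeqCeilingAtBeta 0 0 (7/8) β 0` (every `β > 0`) and to the
literal `U = 0` reading of K1's signature, so that an idle prover can claim either stub `--supports stmt-Ventures-26381`.
HONEST FRAMING: a BC5-type witness of weakness for K1's family (the solver-free member); superconductivity in the Hubbard
model is NOT proved (or disproved) by any of this.

Stubs (v4, 2026-08-29: NO `sorry` left — both former stubs are theorems: the model glue `stub_sectorLogZ_free` is proved in §6,
the analytic core `EsymmLogTwistInsensitive` is the THEOREM `esymmLogTwistInsensitive_holds` of §4; hence `freeGas_rung` (every `β > 0`)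
and K1's literal `U = 0` twin `freeGas_K1twin` (§5) are UNCONDITIONAL, kernel-checked theorems):
* (former stub 1, PROVED in §6) `stub_sectorLogZ_free` — MODEL GLUE (size L, pure algebra, every ingredient in the tree): for `L ≥ 3`
  the `(N_L, S^z = 0)` sector log-partition function of the seam-flux torus at `(t', U) = (0, 0)` is
  `2 · log e_M(w_L(β, θ))`, `e_M` = elementary symmetric polynomial of degree `M = ⌊(7/8)L²/2⌋` in the `L²` twisted
  Boltzmann weights `w_k = exp(−β ξ_k(θ))`, `ξ_k(θ) = twistedBand L ![θ,0] 0 k = −2cos(2πk₁/L − θ/L) − 2cos(2πk₂/L)`.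
* (former stub 2, PROVED in §4) `EsymmLogTwistInsensitive` — ANALYTIC CORE: `|2 log e_M(w_L(β,0)) − 2 log e_M(w_L(β,θ))| ≤ ε_L(β) → 0`
  uniformly on a flux window, eventually in `L`, for every `β > 0` — a statement about symmetric functions of explicit
  reals, no operators. Its own decomposition is §3 (v2, 2026-08-29): the GENERIC inputs are now PROVED in the companion
  module `Cruxes/…/FreeGasArcInputs.lean` (imported; sorry-free) — `shiftedTrapezoidShift_holds` (arc; from the tree's
  Trefethen–Weideman theorem), `offArcGaussianDecay_holds` (off-arc), `esymmModeFugacity_holds` +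
  `prod_one_add_mul_le_of_mode` (DARROCH BYPASS: log-concavity of `e_j` makes EVERY degree a mode at some fugacity, so the
  polynomial floor needs neither Darroch's integer-mean theorem nor Newton nor the IVT), `modeFugacity_pinned` (the mode
  fugacity sits inside the band ± O(1)), `esymmW_fourierCoeff` (contour formula), `freeBandLogStrip_holds` (the one-line
  logarithm is strip-analytic) — and the one MODEL-SPECIFIC input `FreeBandOccupationVariance` is proved below
  (`freeBandOccupationVariance`); §4 assembles them (`pointwise_circle_bound`, `FreeGasArc.Inputs.abs_log_esymmW_sub_le`)
  into `esymmLogTwistInsensitive_holds` with `θ₁ = π`, `ε_L = 128 B L⁴e^{−aL} + 32 L²e^{−cL²}`.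
Proved here: `esymmLogTwistInsensitive_holds` (§4), `freeGasSectorTwistInsensitive_of` (glue + core ⇒ `FreeGasSectorTwistInsensitive 0 (7/8)`),
`freeGas_rung_of` (⇒ the rung at every `β > 0`, constant `0`), `freeGas_K1twin_of'` (⇒ K1 with `8 ↦ 0`), and idea-1's
socket `leafAtBeta_of_twistInsensitiveAt` (verbatim from `ZeroFreeCorridorSketch`, already proved there).
Disproof used: honours `k1_false_without_tendsto_junk` (the limit `L → ∞` is load-bearing: `ε_L → 0` is used through
`Tendsto Ls atTop atTop`), `k1_false_without_theta0_pos` (θ = min θ₀ θ₁ > 0 is where the premise is contradicted); F4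
(polarisation-class blindness) is DODGED, not beaten: no current word, no host — the sector free energy itself is computed.
-/

noncomputable section

/-! ## §I (generic, belongs with `FreeGasArcInputs` §D–§G and is filed in its namespace; kept in this file so that the
companion module need not be rebuilt): pinned mode fugacity in `Fintype` form and the RATIO-TO-LOG STEP. -/

namespace Summit.Ventures.CertifiedManyBodySolver.Cruxes.ThermalStiffnessCeilingU8b10_le_1o8.FreeGasArc.Inputs

open Real Finset
open scoped BigOperators

/-- **Pinned mode fugacity, `Fintype` form.**  For weights `b ≤ xᵢ ≤ B` (`b > 0`) and `1 ≤ M < |ι|` there is a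
fugacity `t > 0` at which `M` is a mode of `j ↦ e_j(x) t^j`, with the polynomial floor and the two pinning
inequalities `(|ι| − M) b t ≤ M + 1`, `M ≤ (|ι| − M + 1) B t`. -/
theorem exists_modeFugacity_pinned {ι : Type} [Fintype ι] [DecidableEq ι] (x : ι → ℝ) {b B : ℝ} (hb : 0 < b)
    (hxb : ∀ i, b ≤ x i) (hxB : ∀ i, x i ≤ B) {M : ℕ} (hM1 : 1 ≤ M) (hM : M < Fintype.card ι) :
    ∃ t : ℝ, 0 < t ∧ (∀ j : ℕ, esymmW x j * t ^ j ≤ esymmW x M * t ^ M) ∧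
      (∏ i, (1 + t * x i)) ≤ ((Fintype.card ι : ℝ) + 1) * (esymmW x M * t ^ M) ∧
      ((Fintype.card ι : ℝ) - M) * b * t ≤ (M : ℝ) + 1 ∧ (M : ℝ) ≤ ((Fintype.card ι : ℝ) - M + 1) * B * t := by
  set X : Multiset ℝ := (Finset.univ : Finset ι).val.map x with hXdef
  have hcard : Multiset.card X = Fintype.card ι := by
    rw [hXdef, Multiset.card_map]
    rfl
  have hmem : ∀ a ∈ X, ∃ i, x i = a := by
    intro a ha
    rw [hXdef, Multiset.mem_map] at ha
    obtain ⟨i, _, rfl⟩ := ha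
    exact ⟨i, rfl⟩
  have hXpos : ∀ a ∈ X, 0 < a := fun a ha => by obtain ⟨i, rfl⟩ := hmem a ha; exact hb.trans_le (hxb i)
  have hXb : ∀ a ∈ X, b ≤ a := fun a ha => by obtain ⟨i, rfl⟩ := hmem a ha; exact hxb i
  have hXB : ∀ a ∈ X, a ≤ B := fun a ha => by obtain ⟨i, rfl⟩ := hmem a ha; exact hxB i
  obtain ⟨t, ht, hmode⟩ := esymm_exists_modeFugacity X hXpos (M := M) (by rw [hcard]; exact hM.le)
  have hpin := modeFugacity_pinned X hb hXb hXB ht (by rw [hcard]; exact hM) hmode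
  rw [hcard] at hpin
  refine ⟨t, ht, ?_, ?_, hpin.1, hpin.2 hM1⟩
  · intro j
    rw [esymmW_eq_esymm, esymmW_eq_esymm]
    exact hmode j
  · rw [esymmW_eq_esymm, ← hcard]
    have hprod : (∏ i, (1 + t * x i)) = (X.map fun a => 1 + t * a).prod := by
      rw [hXdef, Multiset.map_map, Function.comp_def]
      exact (Finset.prod_map_val Finset.univ (fun i => 1 + t * x i)).symm
    rw [hprod]
    exact prod_one_add_mul_le_of_mode X hmode

/-- **The ratio-to-log step (generic).**  If at a fugacity `t` where `M` is a mode for the weights `y` the two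
generating products `∏ᵢ(1 + t xᵢ e^{iφ})`, `∏ᵢ(1 + t yᵢ e^{iφ})` differ by at most `K · ∏ᵢ(1 + t yᵢ)` on the whole
circle, and `(|ι| + 1) K ≤ 1/2`, then `|log e_M(y) − log e_M(x)| ≤ 2 (|ι| + 1) K`.  (Contour formula
`esymmW_fourierCoeff` + polynomial floor.) -/
theorem abs_log_esymmW_sub_le {ι : Type} [Fintype ι] [DecidableEq ι] (x y : ι → ℝ)
    (hx : ∀ i, 0 < x i) (hy : ∀ i, 0 < y i) {t : ℝ} (ht : 0 < t) {M : ℕ} (hM : M ≤ Fintype.card ι)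
    (hmode : ∀ j : ℕ, esymmW y j * t ^ j ≤ esymmW y M * t ^ M) {K : ℝ} (hK : 0 ≤ K)
    (hpt : ∀ φ : ℝ, φ ∈ Set.uIoc (-π) π →
      ‖∏ i, ((1 : ℂ) + ((t * x i : ℝ) : ℂ) * Complex.exp (φ * Complex.I)) -
          ∏ i, ((1 : ℂ) + ((t * y i : ℝ) : ℂ) * Complex.exp (φ * Complex.I))‖ ≤ (∏ i, (1 + t * y i)) * K)
    (hsmall : ((Fintype.card ι : ℝ) + 1) * K ≤ 1 / 2) :
    |Real.log (esymmW y M) - Real.log (esymmW x M)| ≤ 2 * (((Fintype.card ι : ℝ) + 1) * K) := by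
  set η : ℝ := ((Fintype.card ι : ℝ) + 1) * K with hη
  have hη0 : 0 ≤ η := by positivity
  -- Step 1: `|e_M(x) − e_M(y)| t^M ≤ Π_y K` from the contour formula
  have hdiff : |esymmW x M * t ^ M - esymmW y M * t ^ M| ≤ (∏ i, (1 + t * y i)) * K := by
    have hX := esymmW_fourierCoeff x t M
    have hY := esymmW_fourierCoeff y t M
    have hix : IntervalIntegrable (fun φ : ℝ => Complex.exp (-((M : ℂ) * φ * Complex.I)) *
        ∏ i, ((1 : ℂ) + ((t * x i : ℝ) : ℂ) * Complex.exp (φ * Complex.I))) MeasureTheory.volume (-π) π :=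
      Continuous.intervalIntegrable (by fun_prop) _ _
    have hiy : IntervalIntegrable (fun φ : ℝ => Complex.exp (-((M : ℂ) * φ * Complex.I)) *
        ∏ i, ((1 : ℂ) + ((t * y i : ℝ) : ℂ) * Complex.exp (φ * Complex.I))) MeasureTheory.volume (-π) π :=
      Continuous.intervalIntegrable (by fun_prop) _ _
    have hint : ∫ φ in (-π)..π, Complex.exp (-((M : ℂ) * φ * Complex.I)) *
        (∏ i, ((1 : ℂ) + ((t * x i : ℝ) : ℂ) * Complex.exp (φ * Complex.I)) -
          ∏ i, ((1 : ℂ) + ((t * y i : ℝ) : ℂ) * Complex.exp (φ * Complex.I)))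
        = ((2 * π * (esymmW x M * t ^ M - esymmW y M * t ^ M) : ℝ) : ℂ) := by
      simp_rw [mul_sub]
      rw [intervalIntegral.integral_sub hix hiy, hX, hY]
      push_cast
      ring
    have hbound : ∀ φ ∈ Set.uIoc (-π) π, ‖Complex.exp (-((M : ℂ) * φ * Complex.I)) *
        (∏ i, ((1 : ℂ) + ((t * x i : ℝ) : ℂ) * Complex.exp (φ * Complex.I)) -
          ∏ i, ((1 : ℂ) + ((t * y i : ℝ) : ℂ) * Complex.exp (φ * Complex.I)))‖ ≤ (∏ i, (1 + t * y i)) * K := by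
      intro φ hφ
      have he : Complex.exp (-((M : ℂ) * φ * Complex.I)) = Complex.exp (((-((M : ℝ) * φ) : ℝ) : ℂ) * Complex.I) := by
        push_cast
        ring_nf
      rw [norm_mul, he, Complex.norm_exp_ofReal_mul_I, one_mul]
      exact hpt φ hφ
    have hnorm := intervalIntegral.norm_integral_le_of_norm_le_const hbound
    rw [hint, Complex.norm_real, Real.norm_eq_abs, abs_mul, abs_of_pos (by positivity : (0:ℝ) < 2 * π),
      show |π - -π| = 2 * π by rw [sub_neg_eq_add, ← two_mul, abs_of_pos (by positivity)]] at hnorm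
    have hP : 0 ≤ (∏ i, (1 + t * y i)) * K :=
      mul_nonneg (Finset.prod_nonneg fun i _ => by have := hy i; positivity) hK
    nlinarith [Real.pi_pos, hnorm, hP]
  -- Step 2: the polynomial floor `Π_y ≤ (n+1) e_M(y) t^M`
  set X : Multiset ℝ := (Finset.univ : Finset ι).val.map y with hXdef
  have hcard : Multiset.card X = Fintype.card ι := by
    rw [hXdef, Multiset.card_map]
    rfl
  have hfloor : (∏ i, (1 + t * y i)) ≤ ((Fintype.card ι : ℝ) + 1) * (esymmW y M * t ^ M) := by
    rw [esymmW_eq_esymm, ← hcard]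
    have hprod : (∏ i, (1 + t * y i)) = (X.map fun a => 1 + t * a).prod := by
      rw [hXdef, Multiset.map_map, Function.comp_def]
      exact (Finset.prod_map_val Finset.univ (fun i => 1 + t * y i)).symm
    rw [hprod]
    refine prod_one_add_mul_le_of_mode X fun j => ?_
    have := hmode j
    rwa [esymmW_eq_esymm, esymmW_eq_esymm] at this
  -- Step 3: positivity of `e_M` and the ratio bound
  have hposX : ∀ (z : ι → ℝ), (∀ i, 0 < z i) → 0 < esymmW z M := by
    intro z hz
    rw [esymmW_eq_esymm]
    refine esymm_pos _ (fun a ha => ?_) ?_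
    · rw [Multiset.mem_map] at ha
      obtain ⟨i, _, rfl⟩ := ha
      exact hz i
    · rw [Multiset.card_map]
      exact hM
  have heY : 0 < esymmW y M := hposX y hy
  have heX : 0 < esymmW x M := hposX x hx
  have htM : 0 < t ^ M := pow_pos ht M
  have hratio : |esymmW x M - esymmW y M| ≤ η * esymmW y M := by
    have h1 : |esymmW x M - esymmW y M| * t ^ M ≤ η * esymmW y M * t ^ M := by
      calc |esymmW x M - esymmW y M| * t ^ M = |esymmW x M * t ^ M - esymmW y M * t ^ M| := by
            rw [← sub_mul, abs_mul, abs_of_pos htM]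
        _ ≤ (∏ i, (1 + t * y i)) * K := hdiff
        _ ≤ ((Fintype.card ι : ℝ) + 1) * (esymmW y M * t ^ M) * K := mul_le_mul_of_nonneg_right hfloor hK
        _ = η * esymmW y M * t ^ M := by rw [hη]; ring
    exact le_of_mul_le_mul_right h1 htM
  -- Step 4: logarithms: `ρ = e_M(x)/e_M(y) ∈ [1 − η, 1 + η]`, `η ≤ 1/2`
  have hρ : 0 < esymmW x M / esymmW y M := div_pos heX heY
  have hρ1 : |esymmW x M / esymmW y M - 1| ≤ η := by
    rw [show esymmW x M / esymmW y M - 1 = (esymmW x M - esymmW y M) / esymmW y M by field_simp,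
      abs_div, abs_of_pos heY, div_le_iff₀ heY]
    exact hratio
  obtain ⟨hρl, hρu⟩ := abs_le.1 hρ1
  rw [abs_sub_comm, ← Real.log_div heX.ne' heY.ne', abs_le]
  constructor
  · -- lower: `log ρ ≥ 1 − ρ⁻¹ ≥ −2η`
    have hinv : Real.log (esymmW x M / esymmW y M)⁻¹ ≤ (esymmW x M / esymmW y M)⁻¹ - 1 :=
      Real.log_le_sub_one_of_pos (inv_pos.2 hρ)
    rw [Real.log_inv] at hinv
    have hinv2 : (esymmW x M / esymmW y M)⁻¹ ≤ 1 + 2 * η := by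
      rw [inv_le_comm₀ hρ (by positivity), inv_eq_one_div, div_le_iff₀ (by positivity : (0:ℝ) < 1 + 2 * η)]
      nlinarith [hρl, hsmall, hη0]
    linarith
  · have h1 : Real.log (esymmW x M / esymmW y M) ≤ esymmW x M / esymmW y M - 1 := Real.log_le_sub_one_of_pos hρ
    linarith

end Summit.Ventures.CertifiedManyBodySolver.Cruxes.ThermalStiffnessCeilingU8b10_le_1o8.FreeGasArc.Inputs

namespace Summit.Ventures.CertifiedManyBodySolver.Cruxes.ThermalStiffnessCeilingU8b10_le_1o8.FreeGasArc

open Filter Topology Set Real Finset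
open Summit.Ventures.CertifiedManyBodySolver.Observables
open Literature.MathematicalPhysics.QuantumLattice
open Literature.Probability.LatticeModels (TorusSite latticeMomentum)
open scoped BigOperators

/-! ## §0 Idea-1's socket (verbatim from `Cruxes/…/ZeroFreeCorridorSketch.lean`, which is not a built module) -/

/-- [idea-1, `ZeroFreeCorridorSketch.TwistInsensitiveAt`, verbatim] Qualitative twist-insensitivity of the `(N_L, S^z=0)` sector
free energy at inverse temperature `β`: for some flux scale `θ₁ > 0`, `|log Z_L(0) − log Z_L(θ)| ≤ ε_L → 0` uniformly in `|θ| ≤ θ₁`. -/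
def TwistInsensitiveAt (tp U n β : ℝ) : Prop :=
  ∃ θ₁ : ℝ, 0 < θ₁ ∧ ∃ ε : ℕ → ℝ, Tendsto ε atTop (𝓝 0) ∧ ∃ L₀ : ℕ,
    ∀ (L : ℕ) [NeZero L], L₀ ≤ L → ∀ θ : ℝ, |θ| ≤ θ₁ →
      |thermalFluxLogZ L tp U (1 - n) β 0 - thermalFluxLogZ L tp U (1 - n) β θ| ≤ ε L

/-- [idea-1, `ZeroFreeCorridorSketch.leafAtBeta_of_twistInsensitiveAt`, verbatim; PROVED] Twist-insensitivity at `β > 0` forces the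
single-temperature thermal stiffness leaf for every `c ≥ 0`. -/
theorem leafAtBeta_of_twistInsensitiveAt {tp U n β : ℝ} (hβ : 0 < β) {c : ℚ} (_hc : 0 ≤ c)
    (h : TwistInsensitiveAt tp U n β) : ObsThermalStiffnessSeqCeilingAtBeta tp U n β c := by
  intro ρs θ₀ hρs hθ₀ Ls hLs hst
  obtain ⟨θ₁, hθ₁, ε, hε, L₀, hins⟩ := h
  exfalso
  set θ : ℝ := min θ₀ θ₁ with hθdef
  have hθpos : 0 < θ := lt_min hθ₀ hθ₁
  have hθ0 : |θ| ≤ θ₀ := by rw [abs_of_pos hθpos]; exact min_le_left _ _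
  have hθ1 : |θ| ≤ θ₁ := by rw [abs_of_pos hθpos]; exact min_le_right _ _
  have hev : ∀ᶠ j in atTop, β * ρs * θ ^ 2 ≤ ε (Ls j) := by
    have h1 : ∀ᶠ j in atTop, max 1 L₀ ≤ Ls j := hLs.eventually (eventually_ge_atTop (max 1 L₀))
    filter_upwards [h1] with j hj
    haveI : NeZero (Ls j) := ⟨by omega⟩
    have ha := hst j θ hθ0
    have hb := hins (Ls j) (le_of_max_le_right hj) θ hθ1
    exact ha.trans ((le_abs_self _).trans hb)
  have hlim : Tendsto (fun j => ε (Ls j)) atTop (𝓝 0) := hε.comp hLs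
  have hle : β * ρs * θ ^ 2 ≤ 0 := ge_of_tendsto hlim hev
  have hpos : 0 < β * ρs * θ ^ 2 := by positivity
  linarith

/-! ## §1 The witness statement (card) and its readings -/

/-- **Free-gas sector twist-insensitivity** at hopping data `(1, tp)`, `U = 0`, filling `n`: at EVERY `β > 0` the
`(N_L, S^z = 0)` sector log-partition function of the flux-twisted torus is twist-insensitive. -/
def FreeGasSectorTwistInsensitive (tp n : ℝ) : Prop :=
  ∀ β : ℝ, 0 < β → TwistInsensitiveAt tp 0 n β

/-- The witness gives the single-temperature leaf at `U = 0` for EVERY `β > 0` and EVERY `c ≥ 0`. -/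
theorem freeGasLeaf_of {tp n : ℝ} (h : FreeGasSectorTwistInsensitive tp n) {β : ℝ} (hβ : 0 < β) {c : ℚ}
    (hc : 0 ≤ c) : ObsThermalStiffnessSeqCeilingAtBeta tp 0 n β c :=
  leafAtBeta_of_twistInsensitiveAt hβ hc (h β hβ)

/-! ## §2 The explicit free-gas objects and the two (former) stubs — both now theorems -/

/-- The twisted one-body Boltzmann weights of the free band on the `L × L` momentum grid (flux `θ` through the `e₁`-cycle,
boost gauge): `w_k(β, θ) = exp(−β ξ_k(θ))`, `ξ_k(θ) = twistedBand L ![θ, 0] 0 k = −2cos(2πk₁/L − θ/L) − 2cos(2πk₂/L)`. -/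
def freeWeight (L : ℕ) (β θ : ℝ) (k : TorusSite 2 L) : ℝ :=
  Real.exp (-β * twistedBand L ![θ, 0] 0 k)

/-- Electrons per spin species in K1's sector at side `L`: `M_L = ⌊(1 − (1 − 7/8)) L²/2⌋ = ⌊7L²/16⌋` (written exactly as
`thermalFluxLogZ L 0 0 (1 − 7/8) β θ` unfolds it). -/
def halfCount (L : ℕ) : ℕ := ⌊(1 - (1 - 7 / 8 : ℝ)) * (L : ℝ) ^ 2 / 2⌋₊

/-- The `j`-th elementary symmetric function of a weight family `x : ι → ℝ`: `e_j(x) = ∑_{S ⊆ ι, |S| = j} ∏_{i ∈ S} xᵢ`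
(the canonical `j`-particle partition function of ONE free spin species when `xᵢ = e^{−βεᵢ}`). -/
def esymmW {ι : Type} [Fintype ι] [DecidableEq ι] (x : ι → ℝ) (j : ℕ) : ℝ :=
  ∑ S ∈ (Finset.univ : Finset ι).powersetCard j, ∏ i ∈ S, x i

/-! ## §6 (v4, 2026-08-29) STUB 1 PROVED — the model glue, from tree theorems only

Route of the proof of `stub_sectorLogZ_free` (every step a theorem of this section; the names in brackets are the tree inputs):
(a) seam flux ↦ uniform twist [`partitionFn_toBlock_uniformTwistTT'_eq`, `L ≥ 3`]; (b) `magneticHubbardTorus_uniformTwist_eq_dGamma`: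
the uniformly twisted `U = 0` torus Hamiltonian IS `dΓ(twistedOneBody L ![θ,0] 0)` [`magneticHubbardTorus_eq`, `twistedOneBody_apply_orb`];
(c) `partitionFn_toBlock_flux_free_eq_trace`: K1's sector block has partition function `tr(𝟙_{(M,M)} e^{−β dΓ h(θ)})`
[`partitionFn_toBlock_eq_sum_diag`, sector preservation of `dΓ`]; (d)+(e) `trace_exp_spinTwist_mul_gibbsWeight_dGamma_twistedOneBody`:
`tr(e^{Σ_σ f_σ N_σ} e^{−β dΓ h(θ)}) = ∏_k ∏_σ (1 + e^{f_σ} e^{−β ξ_k(θ)})` by plane-wave diagonalisation ON THE ORBITALS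
[`twistedOneBody_eq_conj`, `planeWaveMatrix_mem_unitaryGroup`, `trace_exp_dGamma_unitary_conj_diagonal`, `Matrix.det_conj`];
(f) `sectorTrace_free_eq_esymmW_mul` / `_sq`: the double Fourier coefficient [`trace_sectorIndicator_mul_eq_integral`] factorises and
each factor is `2π e_a(w)` [`FreeGasArc.Inputs.esymmW_fourierCoeff`, shifted to `[0, 2π]` by periodicity], so `Z_{(a,b)} = e_a(w)e_b(w)`
for EVERY spin-resolved sector `(N↑, N↓) = (a, b)`, in particular `Z_{(M,M)} = e_M(w)²`; `thermalFluxLogZ_free_eq` is the glue at any `δ`.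
Technical device: the generic free-fermion lemmas are restated for an arbitrary `DecidableEq` instance (`…_decEq`), because the
orbitals of `FermionTorus 2 L` carry the `Lex`/`Fintype` instance rather than the order-derived one (cf. `partitionFn_dGamma_eq_det_decEq`). -/

section StubOneProof

open Matrix
open Literature.MathematicalPhysics.QuantumFieldTheory
open scoped ComplexConjugate

variable {L : ℕ} [NeZero L]

/-- `ofTorusSite (z + eᵢ) = shift (ofTorusSite z) i`. -/
theorem ofTorusSite_siteShift (z : Site 2 L) (i : Fin 2) :
    FermionTorus.ofTorusSite (Site.shift z i) = FermionTorus.shift (FermionTorus.ofTorusSite z) i := by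
  apply FermionTorus.equivTorusSite.injective
  change FermionTorus.toTorusSite _ = FermionTorus.toTorusSite _
  rw [FermionTorus.toTorusSite_shift, FermionTorus.toTorusSite_ofTorusSite,
    FermionTorus.toTorusSite_ofTorusSite, Site.shift]

/-- `Σ_y [x = y + eᵢ] c • T y = c • T (x − eᵢ)`. -/
theorem sum_ite_eq_shift_smul {M : Type*} [AddCommMonoid M] [Module ℂ M] (x : FermionTorus 2 L) (i : Fin 2)
    (c : ℂ) (T : FermionTorus 2 L → M) :
    ∑ y, (if x = FermionTorus.shift y i then c • T y else 0) = c • T (FermionTorus.unshift x i) := by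
  rw [Finset.sum_eq_single (FermionTorus.unshift x i)]
  · rw [if_pos (FermionTorus.shift_unshift x i).symm]
  · intro y _ hy
    rw [if_neg]
    intro h
    exact hy (by rw [h, FermionTorus.unshift_shift])
  · exact fun h => absurd (Finset.mem_univ _) h

/-- `Σ_y [y = x + eᵢ] c • T y = c • T (x + eᵢ)`. -/
theorem sum_ite_shift_eq_smul {M : Type*} [AddCommMonoid M] [Module ℂ M] (x : FermionTorus 2 L) (i : Fin 2)
    (c : ℂ) (T : FermionTorus 2 L → M) :
    ∑ y, (if y = FermionTorus.shift x i then c • T y else 0) = c • T (FermionTorus.shift x i) := by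
  rw [Finset.sum_eq_single (FermionTorus.shift x i)]
  · rw [if_pos rfl]
  · intro y _ hy
    rw [if_neg hy]
  · exact fun h => absurd (Finset.mem_univ _) h

omit [NeZero L] in
/-- The uniform-twist phase as a complex exponential. -/
theorem coe_circleExp_div (θ : ℝ) :
    ((Circle.exp (θ / L) : Circle) : ℂ) = Complex.exp (Complex.I * ((θ : ℝ) : ℂ) / (L : ℂ)) := by
  rw [Circle.coe_exp]
  congr 1
  push_cast
  ring

omit [NeZero L] in
/-- `conj (exp (iθ/L)) = exp (−iθ/L)`. -/
theorem conj_cexp_I_mul_div (θ : ℝ) :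
    conj (Complex.exp (Complex.I * ((θ : ℝ) : ℂ) / (L : ℂ))) = Complex.exp (-(Complex.I * ((θ : ℝ) : ℂ) / (L : ℂ))) := by
  rw [← Complex.exp_conj, map_div₀, map_mul, Complex.conj_I, Complex.conj_ofReal, Complex.conj_natCast, neg_mul, neg_div]

/-- Reindexing a site sum along the shift `x ↦ x + eᵢ`. -/
theorem sum_shift_reindex {M : Type*} [AddCommMonoid M] (i : Fin 2) (g : FermionTorus 2 L → FermionTorus 2 L → M) :
    ∑ x, g x (FermionTorus.unshift x i) = ∑ x, g (FermionTorus.shift x i) x :=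
  (Fintype.sum_equiv (FermionTorus.shiftEquiv i) (fun x => g (FermionTorus.shift x i) x)
    (fun x => g x (FermionTorus.unshift x i)) (fun x => by
      rw [FermionTorus.shiftEquiv_apply, FermionTorus.unshift_shift])).symm

/-- **(b) The uniformly twisted free torus Hamiltonian is `dΓ` of the boost-gauge twisted hopping matrix**:
`magneticHubbardTorus L (uniformTwistConfig L θ) 1 0 = dΓ(twistedOneBody L (θ, 0) 0)` (both put `−e^{iθ/L}` on `c†_{x+e₁,σ} c_{x,σ}`). -/
theorem magneticHubbardTorus_uniformTwist_eq_dGamma (θ : ℝ) :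
    magneticHubbardTorus L (uniformTwistConfig L θ) 1 0 = dGamma (twistedOneBody L ![θ, 0] 0) := by
  -- normal form of the right-hand side
  have hR : dGamma (twistedOneBody L ![θ, 0] 0) =
      ∑ x : FermionTorus 2 L, ∑ σ : Fin 2, ∑ i : Fin 2,
        ((-Complex.exp (Complex.I * ((![θ, 0] i : ℝ) : ℂ) / (L : ℂ))) •
            (creation (orb (FermionTorus.shift x i) σ) * annihilation (orb x σ)) +
          (-Complex.exp (-(Complex.I * ((![θ, 0] i : ℝ) : ℂ) / (L : ℂ)))) •
            (creation (orb x σ) * annihilation (orb (FermionTorus.shift x i) σ))) := by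
    rw [dGamma_eq, sum_orb_eq_sum_sum]
    simp only [sum_orb_eq_sum_sum, twistedOneBody_apply_orb, Complex.ofReal_zero, ite_self, sub_zero]
    -- collapse the spin sum and the `y`-sums
    have hσ : ∀ (x : FermionTorus 2 L) (σ : Fin 2),
        (∑ y : FermionTorus 2 L, ∑ σ' : Fin 2,
          (if σ = σ' then ∑ i : Fin 2,
            ((if x = FermionTorus.shift y i then -Complex.exp (Complex.I * ((![θ, 0] i : ℝ) : ℂ) / (L : ℂ)) else 0) +
              (if y = FermionTorus.shift x i then -Complex.exp (-(Complex.I * ((![θ, 0] i : ℝ) : ℂ) / (L : ℂ))) else 0))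
            else 0) • (creation (orb x σ) * annihilation (orb y σ'))) =
        ∑ i : Fin 2,
          ((-Complex.exp (Complex.I * ((![θ, 0] i : ℝ) : ℂ) / (L : ℂ))) •
              (creation (orb x σ) * annihilation (orb (FermionTorus.unshift x i) σ)) +
            (-Complex.exp (-(Complex.I * ((![θ, 0] i : ℝ) : ℂ) / (L : ℂ)))) •
              (creation (orb x σ) * annihilation (orb (FermionTorus.shift x i) σ))) := by
      intro x σ
      simp only [ite_smul, zero_smul, Finset.sum_ite_eq, Finset.mem_univ, if_true, Finset.sum_smul, add_smul]
      rw [Finset.sum_comm]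
      refine Finset.sum_congr rfl fun i _ => ?_
      rw [Finset.sum_add_distrib, sum_ite_eq_shift_smul, sum_ite_shift_eq_smul]
    simp only [hσ]
    rw [Finset.sum_comm]
    conv_rhs => rw [Finset.sum_comm]
    refine Finset.sum_congr rfl fun σ _ => ?_
    rw [Finset.sum_comm]
    conv_rhs => rw [Finset.sum_comm]
    refine Finset.sum_congr rfl fun i _ => ?_
    rw [Finset.sum_add_distrib, Finset.sum_add_distrib]
    exact congrArg₂ (· + ·) (sum_shift_reindex i (fun a b =>
      (-Complex.exp (Complex.I * ((![θ, 0] i : ℝ) : ℂ) / (L : ℂ))) • (creation (orb a σ) * annihilation (orb b σ)))) rfl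
  -- normal form of the left-hand side
  rw [hR, magneticHubbardTorus_eq]
  simp only [Complex.ofReal_zero, zero_smul, add_zero, Complex.ofReal_one, neg_smul, one_smul,
    ofTorusSite_siteShift, uniformTwistConfig_apply]
  rw [FermionTorus.sum_eq_sum_torusSite, ← Finset.sum_neg_distrib]
  refine Finset.sum_congr rfl fun z _ => ?_
  simp only [Fin.sum_univ_two, Fin.isValue, if_true, show ((1 : Fin 2) = 0) = False by decide, if_false,
    Matrix.cons_val_zero, Matrix.cons_val_one, coe_circleExp_div, conj_cexp_I_mul_div,
    Circle.coe_one, map_one, one_smul, Complex.ofReal_zero, mul_zero, zero_div, neg_zero, Complex.exp_zero,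
    neg_add]
  abel

/-- **(a)+(b)** `uniformTwistTT' L 0 0 θ = dΓ(twistedOneBody L (θ,0) 0)` (the `t'`-term vanishes). -/
theorem uniformTwistTT'_zero_zero_eq_dGamma (θ : ℝ) :
    uniformTwistTT' L 0 0 θ = dGamma (twistedOneBody L ![θ, 0] 0) := by
  unfold uniformTwistTT'
  rw [magneticHubbardTorus_uniformTwist_eq_dGamma]
  simp only [Complex.ofReal_zero, neg_zero, zero_smul, add_zero]

/-- `dΓ(twistedOneBody)` conserves `(N↑, N↓)`. -/
theorem preservesSectors_dGamma_twistedOneBody (θ : ℝ) :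
    PreservesSectors (dGamma (twistedOneBody L ![θ, 0] 0)) := by
  rw [← magneticHubbardTorus_uniformTwist_eq_dGamma]
  exact preservesSectors_magneticHubbardTorus _ _ _

omit [NeZero L] in
/-- **(c) K1's sector predicate is `#↑ = #↓ = M_L`.** -/
theorem sectorPred_iff_card (M : ℕ) (s : Finset (Orb (FermionTorus 2 L))) :
    (s.card = 2 * M ∧ 2 * (s.filter fun i => (ofLex i).2 = 0).card = 2 * M) ↔
      ((upPart s).card = M ∧ (downPart s).card = M) := by
  rw [Summit.Ventures.CertifiedManyBodySolver.Observables.card_filter_spin_zero_eq_card_upPart',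
    card_eq_upPart_add_downPart s]
  omega

/-- **(c) The sector partition function of the flux torus at `U = t' = 0` is the `(M, M)`-indicator trace of the free
twisted Gibbs weight** (any `M`; K1 uses `M = M_L = ⌊7L²/16⌋`). -/
theorem partitionFn_toBlock_flux_free_eq_trace (hL : 3 ≤ L) (β θ : ℝ) (M : ℕ) :
    partitionFn β ((hubbardTorusTT'Flux L 0 0 θ).toBlock
        (fun s : Finset (Orb (FermionTorus 2 L)) => s.card = 2 * M ∧ 2 * (s.filter fun i => (ofLex i).2 = 0).card = 2 * M)
        (fun s : Finset (Orb (FermionTorus 2 L)) => s.card = 2 * M ∧ 2 * (s.filter fun i => (ofLex i).2 = 0).card = 2 * M)) =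
      ((diagonal fun s : Finset (Orb (FermionTorus 2 L)) =>
          if (upPart s).card = M ∧ (downPart s).card = M then (1 : ℂ) else 0) *
        gibbsWeight β (dGamma (twistedOneBody L ![θ, 0] 0))).trace := by
  rw [← partitionFn_toBlock_uniformTwistTT'_eq hL 0 0 θ β _, uniformTwistTT'_zero_zero_eq_dGamma]
  -- the block to the complement vanishes
  have hK : (dGamma (twistedOneBody L ![θ, 0] 0)).toBlock
      (fun s : Finset (Orb (FermionTorus 2 L)) => s.card = 2 * M ∧ 2 * (s.filter fun i => (ofLex i).2 = 0).card = 2 * M)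
      (fun a => ¬ (a.card = 2 * M ∧ 2 * (a.filter fun i => (ofLex i).2 = 0).card = 2 * M)) = 0 := by
    ext a b
    rw [toBlock_apply, Matrix.zero_apply]
    by_contra hne
    have hs := preservesSectors_dGamma_twistedOneBody θ a.1 b.1 hne
    have ha : (upPart (a : Finset (Orb (FermionTorus 2 L)))).card = M ∧
        (downPart (a : Finset (Orb (FermionTorus 2 L)))).card = M := (sectorPred_iff_card M _).1 a.2
    exact b.2 ((sectorPred_iff_card M _).2 ⟨hs.1 ▸ ha.1, hs.2 ▸ ha.2⟩)
  rw [Summit.Ventures.CertifiedManyBodySolver.Observables.partitionFn_toBlock_eq_sum_diag β _ _ hK,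
    Summit.HubbardSuperconductivity.HubbardSuperconductivity.Theorems.trace_diagonal_mul_eq_sum, Finset.sum_filter]
  refine Finset.sum_congr rfl fun s _ => ?_
  rw [ite_mul, one_mul, zero_mul]
  exact if_congr (sectorPred_iff_card M s) rfl rfl

/-! ### Generic free-fermion lemmas, restated for an arbitrary `DecidableEq` instance
(the orbitals of the fermionic torus carry the `Lex`/`Fintype` instance, not the one derived from the linear order —
same device as `partitionFn_dGamma_eq_det_decEq` in `TwistedHoppingPlaneWaves`). -/

section DecEq

/-- `trace_exp_dGamma_unitary_conj_diagonal` for an arbitrary `DecidableEq` instance on the index type. -/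
theorem trace_exp_dGamma_unitary_conj_diagonal_decEq {ι : Type*} [DecidableEq ι] [LinearOrder ι] [Fintype ι]
    (U : Matrix.unitaryGroup ι ℂ) (d : ι → ℂ) :
    (NormedSpace.exp (dGamma ((U : Matrix ι ι ℂ) * diagonal d * star (U : Matrix ι ι ℂ)))).trace =
      (1 + NormedSpace.exp ((U : Matrix ι ι ℂ) * diagonal d * star (U : Matrix ι ι ℂ))).det := by
  have e : (‹DecidableEq ι› : DecidableEq ι) = LinearOrder.toDecidableEq := Subsingleton.elim _ _
  subst e
  exact trace_exp_dGamma_unitary_conj_diagonal U d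

/-- `sum_smul_spinNumber_eq_dGamma` for an arbitrary `DecidableEq` instance on the sites. -/
theorem sum_smul_spinNumber_eq_dGamma_decEq {Λ : Type*} [DecidableEq Λ] [LinearOrder Λ] [Fintype Λ] (f : Fin 2 → ℂ) :
    ∑ σ : Fin 2, f σ • ∑ x : Λ, numberAt (orb x σ) = dGamma (diagonal fun o : Orb Λ => f (ofLex o).2) := by
  have e : (‹DecidableEq Λ› : DecidableEq Λ) = LinearOrder.toDecidableEq := Subsingleton.elim _ _
  subst e
  exact sum_smul_spinNumber_eq_dGamma f

/-- `exp_sum_smul_spinNumber_eq_diagonal` for an arbitrary `DecidableEq` instance on the sites. -/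
theorem exp_sum_smul_spinNumber_eq_diagonal_decEq {Λ : Type*} [DecidableEq Λ] [LinearOrder Λ] [Fintype Λ] (f : Fin 2 → ℂ) :
    NormedSpace.exp (∑ σ : Fin 2, f σ • ∑ x : Λ, numberAt (orb x σ)) =
      diagonal fun s : Finset (Orb Λ) => Complex.exp (f 0 * (upPart s).card + f 1 * (downPart s).card) := by
  have e : (‹DecidableEq Λ› : DecidableEq Λ) = LinearOrder.toDecidableEq := Subsingleton.elim _ _
  subst e
  exact exp_sum_smul_spinNumber_eq_diagonal f

/-- `trace_sectorIndicator_mul_eq_integral` (BalabanIR…SectorFourier) for an arbitrary `DecidableEq` instance on the sites. -/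
theorem trace_sectorIndicator_mul_eq_integral_decEq {Λ : Type*} [DecidableEq Λ] [LinearOrder Λ] [Fintype Λ] (a b : ℕ)
    (X : Matrix (Finset (Orb Λ)) (Finset (Orb Λ)) ℂ) :
    ((diagonal fun s : Finset (Orb Λ) =>
        if (upPart s).card = a ∧ (downPart s).card = b then (1 : ℂ) else 0) * X).trace =
      (1 / (2 * Real.pi) ^ 2 : ℂ) *
        ∫ φ in (0:ℝ)..2 * Real.pi, ∫ χ in (0:ℝ)..2 * Real.pi,
          Complex.exp (-((((a : ℝ) * φ + (b : ℝ) * χ : ℝ) : ℂ) * Complex.I)) *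
            ((diagonal fun s : Finset (Orb Λ) =>
              Complex.exp (((((upPart s).card : ℝ) * φ + ((downPart s).card : ℝ) * χ : ℝ) : ℂ) * Complex.I)) *
                X).trace := by
  have e : (‹DecidableEq Λ› : DecidableEq Λ) = LinearOrder.toDecidableEq := Subsingleton.elim _ _
  subst e
  exact Summit.HubbardSuperconductivity.HubbardSuperconductivity.Theorems.trace_sectorIndicator_mul_eq_integral a b X

end DecEq

/-! ### (d)+(e) The spin-twisted trace of the free twisted Gibbs weight, in closed form -/

omit [NeZero L] in
/-- A spin-diagonal matrix on the orbitals commutes with every spin-only diagonal `diag(f_{σ(o)})`. -/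
theorem commute_spinDiagonal {A : Matrix (Orb (FermionTorus 2 L)) (Orb (FermionTorus 2 L)) ℂ}
    (hA : ∀ o o', (ofLex o).2 ≠ (ofLex o').2 → A o o' = 0) (f : Fin 2 → ℂ) :
    Commute (diagonal fun o : Orb (FermionTorus 2 L) => f (ofLex o).2) A := by
  change (diagonal fun o : Orb (FermionTorus 2 L) => f (ofLex o).2) * A =
    A * diagonal fun o : Orb (FermionTorus 2 L) => f (ofLex o).2
  ext o o'
  rw [diagonal_mul, mul_diagonal]
  by_cases h : (ofLex o).2 = (ofLex o').2
  · rw [h, mul_comm]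
  · rw [hA o o' h, mul_zero, zero_mul]

/-- The twisted hopping matrix is diagonal in spin. -/
theorem twistedOneBody_spin_offdiag (θ2 : Fin 2 → ℝ) (μ : ℝ) (o o' : Orb (FermionTorus 2 L))
    (h : (ofLex o).2 ≠ (ofLex o').2) : twistedOneBody L θ2 μ o o' = 0 := by
  rw [twistedOneBody, Matrix.of_apply, if_neg h, if_neg (fun e => h (by rw [e])), sub_zero]

/-- The plane-wave matrix is diagonal in spin. -/
theorem planeWaveMatrix_spin_offdiag (o o' : Orb (FermionTorus 2 L)) (h : (ofLex o).2 ≠ (ofLex o').2) :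
    planeWaveMatrix 2 L o o' = 0 := by
  simp only [planeWaveMatrix, Matrix.of_apply, planeWave, if_neg h, mul_zero]

/-- **(d)+(e) The spin-twisted trace formula for the free twisted torus gas, diagonalised by plane waves:**
`tr (exp(Σ_σ f_σ N_σ) e^{−β dΓ(h(θ))}) = ∏_k ∏_σ (1 + e^{f_σ} e^{−β ξ_k(θ)})`. -/
theorem trace_exp_spinTwist_mul_gibbsWeight_dGamma_twistedOneBody (β : ℝ) (θ2 : Fin 2 → ℝ) (f : Fin 2 → ℂ) :
    (NormedSpace.exp (∑ σ : Fin 2, f σ • ∑ x : FermionTorus 2 L, numberAt (orb x σ)) *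
        gibbsWeight β (dGamma (twistedOneBody L θ2 0))).trace =
      ∏ k : TorusSite 2 L, ∏ σ : Fin 2,
        (1 + Complex.exp (f σ) * ((Real.exp (-(β * twistedBand L θ2 0 k)) : ℝ) : ℂ)) := by
  set D : Matrix (Orb (FermionTorus 2 L)) (Orb (FermionTorus 2 L)) ℂ := diagonal fun o => f (ofLex o).2 with hDdef
  set h : Matrix (Orb (FermionTorus 2 L)) (Orb (FermionTorus 2 L)) ℂ := twistedOneBody L θ2 0 with hh
  set F : Matrix (Orb (FermionTorus 2 L)) (Orb (FermionTorus 2 L)) ℂ := planeWaveMatrix 2 L with hF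
  set ξ : Orb (FermionTorus 2 L) → ℝ := twistedBandOrb L θ2 0 with hξ
  have hDh : Commute D h := commute_spinDiagonal (twistedOneBody_spin_offdiag θ2 0) f
  have hDF : Commute D F := commute_spinDiagonal planeWaveMatrix_spin_offdiag f
  -- (1) the product of exponentials is `exp (dΓ (D - β h))`
  have hcomm : Commute (dGamma D) (-(β : ℂ) • dGamma h) := (commute_dGamma_of_commute hDh).smul_right _
  have hprod : NormedSpace.exp (∑ σ : Fin 2, f σ • ∑ x : FermionTorus 2 L, numberAt (orb x σ)) * gibbsWeight β (dGamma h) =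
      NormedSpace.exp (dGamma (D - (β : ℂ) • h)) := by
    rw [sum_smul_spinNumber_eq_dGamma_decEq, gibbsWeight, ← Matrix.exp_add_of_commute _ _ hcomm, ← dGamma_smul, ← dGamma_add,
      neg_smul, ← sub_eq_add_neg]
  -- (2) `D - β h = F diag(d) F⋆`
  have hFF : F * star F = 1 := by rw [star_eq_conjTranspose]; exact planeWaveMatrix_mul_conjTranspose
  set d : Orb (FermionTorus 2 L) → ℂ := fun o => f (ofLex o).2 - (β : ℂ) * ((ξ o : ℝ) : ℂ) with hd
  have hX : D - (β : ℂ) • h = F * diagonal d * star F := by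
    have h1 : D = F * D * star F := by rw [← hDF.eq, Matrix.mul_assoc, hFF, Matrix.mul_one]
    have h2 : h = F * diagonal (fun o => ((ξ o : ℝ) : ℂ)) * star F := by
      rw [star_eq_conjTranspose]; exact twistedOneBody_eq_conj θ2 0
    have h3 : diagonal d = D - (β : ℂ) • diagonal (fun o => ((ξ o : ℝ) : ℂ)) := by
      rw [hDdef, ← diagonal_smul, ← diagonal_sub]
      rfl
    rw [h3, Matrix.mul_sub, Matrix.sub_mul, ← h1, Matrix.mul_smul, Matrix.smul_mul, ← h2]
  -- (3) the trace formula for a unitarily diagonalised one-body matrix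
  have htrace := trace_exp_dGamma_unitary_conj_diagonal_decEq ⟨F, planeWaveMatrix_mem_unitaryGroup⟩ d
  simp only at htrace
  rw [hprod, hX, htrace]
  -- (4) `det (1 + F diag(e^d) F⋆) = ∏_o (1 + e^{d_o})`
  have hFinv : F⁻¹ = star F := Matrix.inv_eq_right_inv hFF
  have hFunit : IsUnit F := (Matrix.isUnit_iff_isUnit_det _).mpr (Matrix.isUnit_det_of_right_inverse hFF)
  have hexp : NormedSpace.exp (F * diagonal d * star F) = F * diagonal (fun o => Complex.exp (d o)) * star F := by
    rw [← hFinv, Matrix.exp_conj _ _ hFunit, Matrix.exp_diagonal]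
    congr 2
    funext o
    rw [Pi.exp_def, Complex.exp_eq_exp_ℂ]
  have h1 : 1 + F * diagonal (fun o => Complex.exp (d o)) * star F =
      F * (1 + diagonal fun o => Complex.exp (d o)) * F⁻¹ := by
    rw [hFinv, Matrix.mul_add, Matrix.add_mul, Matrix.mul_one, hFF]
  rw [hexp, h1, Matrix.det_conj hFunit, ← diagonal_one, diagonal_add, det_diagonal, prod_orb_eq_prod_prod]
  -- (5) read the diagonal off: `d_{(x,σ)} = f_σ − β ξ_x`
  refine Fintype.prod_equiv FermionTorus.equivTorusSite _ _ fun x => ?_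
  change _ = ∏ σ : Fin 2, (1 + Complex.exp (f σ) * ((Real.exp (-(β * twistedBand L θ2 0 x.toTorusSite)) : ℝ) : ℂ))
  refine Finset.prod_congr rfl fun σ _ => ?_
  simp only [hd, hξ, twistedBandOrb, ofLex_orb]
  rw [Complex.ofReal_exp, ← Complex.exp_add]
  congr 2
  push_cast
  ring

/-! ### (f) Fourier extraction: the `(M, M)` sector trace is `e_M(w)²` -/

/-- **Coefficient extraction on `[0, 2π]` at fugacity `1`:** `∫₀^{2π} e^{−iMφ} ∏_k (1 + w_k e^{iφ}) dφ = 2π e_M(w)`. -/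
theorem integral_twistChar_prod {ι : Type} [Fintype ι] [DecidableEq ι] (w : ι → ℝ) (M : ℕ) :
    ∫ φ in (0:ℝ)..2 * π, Complex.exp (-((M : ℂ) * φ * Complex.I)) * ∏ k, ((1 : ℂ) + (w k : ℂ) * Complex.exp (φ * Complex.I))
      = 2 * π * ((esymmW w M : ℝ) : ℂ) := by
  have hper : Function.Periodic (fun φ : ℝ => Complex.exp (-((M : ℂ) * φ * Complex.I)) *
      ∏ k, ((1 : ℂ) + (w k : ℂ) * Complex.exp (φ * Complex.I))) (2 * π) := by
    intro φ
    have h1 : Complex.exp (((φ + 2 * π : ℝ) : ℂ) * Complex.I) = Complex.exp ((φ : ℂ) * Complex.I) := by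
      push_cast
      rw [add_mul, Complex.exp_add, Complex.exp_two_pi_mul_I, mul_one]
    have h2 : Complex.exp (-((M : ℂ) * ((φ + 2 * π : ℝ) : ℂ) * Complex.I)) = Complex.exp (-((M : ℂ) * φ * Complex.I)) := by
      rw [show -((M : ℂ) * ((φ + 2 * π : ℝ) : ℂ) * Complex.I) =
          -((M : ℂ) * φ * Complex.I) + ((-(M : ℤ) : ℤ) : ℂ) * (2 * π * Complex.I) by push_cast; ring,
        Complex.exp_add, Complex.exp_int_mul_two_pi_mul_I, mul_one]
    show Complex.exp (-((M : ℂ) * ((φ + 2 * π : ℝ) : ℂ) * Complex.I)) *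
        ∏ k, ((1 : ℂ) + (w k : ℂ) * Complex.exp (((φ + 2 * π : ℝ) : ℂ) * Complex.I)) = _
    rw [h1, h2]
  have hshift := hper.intervalIntegral_add_eq (-π) 0
  rw [zero_add, show -π + 2 * π = π by ring] at hshift
  rw [← hshift]
  have h3 := FreeGasArc.Inputs.esymmW_fourierCoeff w 1 M
  simp only [one_mul, one_pow, mul_one] at h3
  exact h3  -- `esymmW` here and `FreeGasArc.Inputs.esymmW` have the same body (`esymmW_eq_inputs` below is `rfl`)

/-- **(f) The `(a, b)` sector trace of the free twisted Gibbs weight is `e_a(w(β,θ)) · e_b(w(β,θ))`** (general spin-resolved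
particle numbers; the `(N↑, N↓) = (a, b)` canonical partition function of the free twisted torus gas). -/
theorem sectorTrace_free_eq_esymmW_mul (β θ : ℝ) (a b : ℕ) :
    ((diagonal fun s : Finset (Orb (FermionTorus 2 L)) =>
        if (upPart s).card = a ∧ (downPart s).card = b then (1 : ℂ) else 0) *
      gibbsWeight β (dGamma (twistedOneBody L ![θ, 0] 0))).trace =
      ((esymmW (freeWeight L β θ) a * esymmW (freeWeight L β θ) b : ℝ) : ℂ) := by
  rw [trace_sectorIndicator_mul_eq_integral_decEq]
  -- the twisted trace in closed form
  have htw : ∀ φ χ : ℝ,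
      ((diagonal fun s : Finset (Orb (FermionTorus 2 L)) =>
          Complex.exp (((((upPart s).card : ℝ) * φ + ((downPart s).card : ℝ) * χ : ℝ) : ℂ) * Complex.I)) *
        gibbsWeight β (dGamma (twistedOneBody L ![θ, 0] 0))).trace =
      (∏ k, ((1 : ℂ) + (freeWeight L β θ k : ℂ) * Complex.exp (φ * Complex.I))) *
        ∏ k, ((1 : ℂ) + (freeWeight L β θ k : ℂ) * Complex.exp (χ * Complex.I)) := by
    intro φ χ
    have hdiag : (diagonal fun s : Finset (Orb (FermionTorus 2 L)) =>
          Complex.exp (((((upPart s).card : ℝ) * φ + ((downPart s).card : ℝ) * χ : ℝ) : ℂ) * Complex.I)) =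
        NormedSpace.exp (∑ σ : Fin 2, (![(φ : ℂ) * Complex.I, (χ : ℂ) * Complex.I] σ) •
          ∑ x : FermionTorus 2 L, numberAt (orb x σ)) := by
      rw [exp_sum_smul_spinNumber_eq_diagonal_decEq]
      congr 1
      funext s
      congr 1
      simp only [Matrix.cons_val_zero, Matrix.cons_val_one]
      push_cast
      ring
    rw [hdiag, trace_exp_spinTwist_mul_gibbsWeight_dGamma_twistedOneBody, ← Finset.prod_mul_distrib]
    refine Finset.prod_congr rfl fun k _ => ?_
    simp only [Fin.prod_univ_two, Matrix.cons_val_zero, Matrix.cons_val_one, freeWeight, neg_mul]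
    ring
  simp_rw [htw]
  -- factorise the double integral
  have hsplit : ∀ φ χ : ℝ, Complex.exp (-((((a : ℝ) * φ + (b : ℝ) * χ : ℝ) : ℂ) * Complex.I)) *
      ((∏ k, ((1 : ℂ) + (freeWeight L β θ k : ℂ) * Complex.exp (φ * Complex.I))) *
        ∏ k, ((1 : ℂ) + (freeWeight L β θ k : ℂ) * Complex.exp (χ * Complex.I))) =
      (Complex.exp (-((a : ℂ) * φ * Complex.I)) * ∏ k, ((1 : ℂ) + (freeWeight L β θ k : ℂ) * Complex.exp (φ * Complex.I))) *
        (Complex.exp (-((b : ℂ) * χ * Complex.I)) *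
          ∏ k, ((1 : ℂ) + (freeWeight L β θ k : ℂ) * Complex.exp (χ * Complex.I))) := by
    intro φ χ
    rw [show -((((a : ℝ) * φ + (b : ℝ) * χ : ℝ) : ℂ) * Complex.I) =
        -((a : ℂ) * φ * Complex.I) + -((b : ℂ) * χ * Complex.I) by push_cast; ring, Complex.exp_add]
    ring
  simp_rw [hsplit, intervalIntegral.integral_const_mul, intervalIntegral.integral_mul_const, integral_twistChar_prod]
  have hπ : (π : ℂ) ≠ 0 := by exact_mod_cast Real.pi_ne_zero
  push_cast
  field_simp

/-- **(f) The `(M, M)` sector trace of the free twisted Gibbs weight is `e_M(w(β,θ))²`.** -/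
theorem sectorTrace_free_eq_esymmW_sq (β θ : ℝ) (M : ℕ) :
    ((diagonal fun s : Finset (Orb (FermionTorus 2 L)) =>
        if (upPart s).card = M ∧ (downPart s).card = M then (1 : ℂ) else 0) *
      gibbsWeight β (dGamma (twistedOneBody L ![θ, 0] 0))).trace = (((esymmW (freeWeight L β θ) M) ^ 2 : ℝ) : ℂ) := by
  rw [sectorTrace_free_eq_esymmW_mul, sq]

end StubOneProof

/-- **MODEL GLUE (stub 1) — PROVED (v4, §6 above).** For `L ≥ 3` and every `β, θ`: the `(N_L, S^z = 0)` sector log-partition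
function of `hubbardTorusTT'Flux L 0 0 θ` equals `2 log e_{M_L}(w_L(β,θ))` (`e_M` = elementary symmetric function of degree
`M_L = ⌊(7/8)L²/2⌋` of the `L²` twisted Boltzmann weights `w_k = exp(−β ξ_k(θ))`). The name is kept from v1–v3, where this was
the sorried stub; it is now a theorem, so every composition of §5 below is unconditional. -/
theorem stub_sectorLogZ_free (β θ : ℝ) (L : ℕ) [NeZero L] (hL : 3 ≤ L) :
    thermalFluxLogZ L 0 0 (1 - 7 / 8) β θ = 2 * Real.log (esymmW (freeWeight L β θ) (halfCount L)) := by
  rw [thermalFluxLogZ, halfCount, partitionFn_toBlock_flux_free_eq_trace hL β θ, sectorTrace_free_eq_esymmW_sq,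
    Complex.ofReal_re, Real.log_pow, Nat.cast_ofNat]

/-- The same glue at an arbitrary filling parameter `δ` (sector `N↑ = N↓ = ⌊(1 − δ)L²/2⌋`): for `L ≥ 3`,
`thermalFluxLogZ L 0 0 δ β θ = 2 log e_{⌊(1−δ)L²/2⌋}(w_L(β, θ))` — re-usable by the crux's other `U = 0` calibrations. -/
theorem thermalFluxLogZ_free_eq (δ β θ : ℝ) (L : ℕ) [NeZero L] (hL : 3 ≤ L) :
    thermalFluxLogZ L 0 0 δ β θ = 2 * Real.log (esymmW (freeWeight L β θ) ⌊(1 - δ) * (L : ℝ) ^ 2 / 2⌋₊) := by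
  rw [thermalFluxLogZ, partitionFn_toBlock_flux_free_eq_trace hL β θ, sectorTrace_free_eq_esymmW_sq,
    Complex.ofReal_re, Real.log_pow, Nat.cast_ofNat]

/-- The analytic core as a `Prop`: for every `β > 0`, `2 log e_{M_L}(w_L(β, ·))` is twist-insensitive on a flux window,
eventually in `L`, with a null sequence `ε_L(β)` (card: `ε_L ≤ C(β) L² e^{−a(β)L}` with `a(β) = arsinh((π − φ₀)/(2β))`-type
strip width; crit-1: vacuous below `L ≈ 200` at `β = 10`, irrelevant for the `L → ∞` leaf). -/
def EsymmLogTwistInsensitive : Prop :=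
  ∀ β : ℝ, 0 < β → ∃ θ₁ : ℝ, 0 < θ₁ ∧ ∃ ε : ℕ → ℝ, Tendsto ε atTop (𝓝 0) ∧ ∃ L₀ : ℕ,
    ∀ (L : ℕ) [NeZero L], L₀ ≤ L → ∀ θ : ℝ, |θ| ≤ θ₁ →
      |2 * Real.log (esymmW (freeWeight L β 0) (halfCount L)) -
          2 * Real.log (esymmW (freeWeight L β θ) (halfCount L))| ≤ ε L

-- v3: the former `stub_esymmLogTwistInsensitive` is the theorem `esymmLogTwistInsensitive_holds` (§4); v4: the former stub 1 is the
-- theorem `stub_sectorLogZ_free` (§6, placed above); the rung and K1's `U = 0` twin `freeGas_rung` / `freeGas_K1twin` (§5) are unconditional.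

/-! ### The kernel-checked composition -/

/-- Stub 1 as a `Prop` (the shape consumed by the composition). -/
def SectorLogZFreeFactorisation : Prop :=
  ∀ (β θ : ℝ) (L : ℕ) [NeZero L], 3 ≤ L →
    thermalFluxLogZ L 0 0 (1 - 7 / 8) β θ = 2 * Real.log (esymmW (freeWeight L β θ) (halfCount L))

/-- Stub 1's `Prop` holds (by `stub_sectorLogZ_free`). -/
theorem sectorLogZFreeFactorisation_of_stub : SectorLogZFreeFactorisation :=
  fun β θ L _ hL => stub_sectorLogZ_free β θ L hL

/-- **Composition (PROVED):** model glue + analytic core ⇒ the card's witness `FreeGasSectorTwistInsensitive 0 (7/8)`. -/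
theorem freeGasSectorTwistInsensitive_of (h1 : SectorLogZFreeFactorisation) (h2 : EsymmLogTwistInsensitive) :
    FreeGasSectorTwistInsensitive 0 (7 / 8) := by
  intro β hβ
  obtain ⟨θ₁, hθ₁, ε, hε, L₀, hins⟩ := h2 β hβ
  refine ⟨θ₁, hθ₁, ε, hε, max 3 L₀, ?_⟩
  intro L _ hL θ hθ
  rw [h1 β 0 L (le_of_max_le_left hL), h1 β θ L (le_of_max_le_left hL)]
  exact hins L (le_of_max_le_right hL) θ hθ

/-- **The rung (PROVED from the two stubs):** `ObsThermalStiffnessSeqCeilingAtBeta 0 0 (7/8) β 0` for every `β > 0` — K1's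
exact observable family with the interaction switched off and the constant `0` (K1 has `U = 8`, constant `1/8`). -/
theorem freeGas_rung_of (h1 : SectorLogZFreeFactorisation) (h2 : EsymmLogTwistInsensitive) {β : ℝ} (hβ : 0 < β) :
    ObsThermalStiffnessSeqCeilingAtBeta 0 0 (7 / 8) β 0 :=
  freeGasLeaf_of (freeGasSectorTwistInsensitive_of h1 h2) hβ le_rfl

/-- **K1's literal `U = 0` twin (PROVED from the two stubs):** `ObsThermalStiffnessSeqCeilingAtBeta 0 0 (7/8) 10 (1/8)`. -/
theorem freeGas_K1twin_of' (h1 : SectorLogZFreeFactorisation) (h2 : EsymmLogTwistInsensitive) :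
    ObsThermalStiffnessSeqCeilingAtBeta 0 0 (7 / 8) 10 (1 / 8) :=
  freeGasLeaf_of (freeGasSectorTwistInsensitive_of h1 h2) (by norm_num) (by norm_num)

/-! ## §3 Second layer for stub 2 (v2): EVERY input is now a theorem — generic ones imported from `FreeGasArcInputs`,
the one model-specific one (`FreeBandOccupationVariance`) proved here; stub 2 is the bookkeeping assembly. -/

/-- The skeleton's `esymmW` is the companion module's `esymmW` (same body). -/
theorem esymmW_eq_inputs {ι : Type} [Fintype ι] [DecidableEq ι] (x : ι → ℝ) (j : ℕ) :
    esymmW x j = FreeGasArc.Inputs.esymmW x j := rfl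

/-- PROVED generic input (arc): the shifted-grid trapezoid bound (Trefethen–Weideman, tree). -/
theorem shiftedTrapezoidShift : FreeGasArc.Inputs.ShiftedTrapezoidShift :=
  FreeGasArc.Inputs.shiftedTrapezoidShift_holds

/-- PROVED generic input (off-arc): Gaussian decay of `∏(1 + uᵢe^{iφ})` away from `φ = 0`. -/
theorem offArcGaussianDecay : FreeGasArc.Inputs.OffArcGaussianDecay :=
  FreeGasArc.Inputs.offArcGaussianDecay_holds

/-- PROVED generic input (floor; the Darroch bypass): every degree is a mode at some fugacity, polynomial floor. -/
theorem esymmModeFugacity : FreeGasArc.Inputs.EsymmModeFugacity :=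
  FreeGasArc.Inputs.esymmModeFugacity_holds

/-- PROVED generic input (strip): the one-line logarithm `Log(1 + exp(s + iφ + 2β cos z + 2β cos p₂))` is
`2π`-periodic, holomorphic and bounded on `|Im z| < min 1 (π/(24β))`, and exponentiates back on the real line. -/
theorem freeBandLogStrip : FreeGasArc.Inputs.FreeBandLogStrip :=
  FreeGasArc.Inputs.freeBandLogStrip_holds

/-- **Model-specific input (the only one): the occupation variance is extensive on the pinned fugacity window.**
For `β > 0` there are `c > 0` and `L₀` such that for all `L ≥ L₀`, all real `θ` with `|θ| ≤ π` and every log-fugacity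
`s ∈ [−4β − 1, 4β + 1]`, `∑_k u_k/(1 + u_k)² ≥ c·L²` with `u_k = e^{s} w_k(β, θ)`.  (Pinning to this window:
`FreeGasArc.Inputs.modeFugacity_pinned` with `b = e^{−4β}`, `B = e^{4β}`, `M_L = ⌊7L²/16⌋`, `n = L²`.) -/
def FreeBandOccupationVariance : Prop :=
  ∀ β : ℝ, 0 < β → ∃ c : ℝ, 0 < c ∧ ∃ L₀ : ℕ, ∀ (L : ℕ) [NeZero L], L₀ ≤ L → ∀ θ : ℝ, |θ| ≤ π →
    ∀ s : ℝ, -4 * β - 1 ≤ s → s ≤ 4 * β + 1 →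
      c * (L : ℝ) ^ 2 ≤ ∑ k : TorusSite 2 L,
        Real.exp s * freeWeight L β θ k / (1 + Real.exp s * freeWeight L β θ k) ^ 2

/-- The twisted free band is bounded by `4`: `|ξ_k(θ)| = |−2cos(p₁ − θ/L) − 2cos p₂| ≤ 4`. -/
theorem abs_twistedBand_le (L : ℕ) (θ : ℝ) (k : TorusSite 2 L) : |twistedBand L ![θ, 0] 0 k| ≤ 4 := by
  unfold twistedBand
  rw [sub_zero, Fin.sum_univ_two]
  have hA := abs_le.1 (Real.abs_cos_le_one (latticeMomentum L k 0 - (![θ, 0] : Fin 2 → ℝ) 0 / L))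
  have hB := abs_le.1 (Real.abs_cos_le_one (latticeMomentum L k 1 - (![θ, 0] : Fin 2 → ℝ) 1 / L))
  rw [abs_le]
  constructor <;> nlinarith [hA.1, hA.2, hB.1, hB.2]

/-- **The model-specific input holds**, with `c = e^{−(8β+1)}/4` and `L₀ = 0`: EVERY mode contributes, since
`|s − βξ_k| ≤ 8β + 1` and `u/(1+u)² ≥ e^{−|log u|}/4` (no shell counting is needed for the `L → ∞` leaf). -/
theorem freeBandOccupationVariance : FreeBandOccupationVariance := by
  intro β hβ
  refine ⟨Real.exp (-(8 * β + 1)) / 4, by positivity, 0, ?_⟩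
  intro L _ _ θ _ s hs1 hs2
  have hcard : (Fintype.card (TorusSite 2 L) : ℝ) = (L : ℝ) ^ 2 := by
    rw [Fintype.card_fun, ZMod.card, Fintype.card_fin]
    push_cast
    ring
  have hterm : ∀ k : TorusSite 2 L, Real.exp (-(8 * β + 1)) / 4 ≤
      Real.exp s * freeWeight L β θ k / (1 + Real.exp s * freeWeight L β θ k) ^ 2 := by
    intro k
    have hξ := abs_le.1 (abs_twistedBand_le L θ k)
    have hu : Real.exp s * freeWeight L β θ k = Real.exp (s + -β * twistedBand L ![θ, 0] 0 k) := by
      rw [freeWeight, Real.exp_add]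
    rw [hu]
    have hx1 : -(8 * β + 1) ≤ s + -β * twistedBand L ![θ, 0] 0 k := by nlinarith [hξ.1, hξ.2, hβ]
    have hx2 : s + -β * twistedBand L ![θ, 0] 0 k ≤ 8 * β + 1 := by nlinarith [hξ.1, hξ.2, hβ]
    have hupos : 0 < Real.exp (s + -β * twistedBand L ![θ, 0] 0 k) := Real.exp_pos _
    rw [div_le_div_iff₀ (by norm_num : (0:ℝ) < 4) (by positivity)]
    have h1 : Real.exp (-(8 * β + 1)) ≤ Real.exp (s + -β * twistedBand L ![θ, 0] 0 k) := Real.exp_le_exp.2 hx1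
    have h2 : Real.exp (-(8 * β + 1)) * Real.exp (s + -β * twistedBand L ![θ, 0] 0 k) ≤ 1 := by
      rw [← Real.exp_add]
      exact Real.exp_le_one_iff.2 (by linarith)
    have h3 : Real.exp (-(8 * β + 1)) ≤ 1 := Real.exp_le_one_iff.2 (by linarith)
    nlinarith [hupos, h1, h2, h3, mul_le_mul_of_nonneg_right h2 hupos.le, mul_le_mul_of_nonneg_right h3 hupos.le]
  calc Real.exp (-(8 * β + 1)) / 4 * (L : ℝ) ^ 2
      = ∑ _k : TorusSite 2 L, Real.exp (-(8 * β + 1)) / 4 := by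
        rw [Finset.sum_const, Finset.card_univ, nsmul_eq_mul, hcard]
        ring
    _ ≤ _ := Finset.sum_le_sum fun k _ => hterm k

/-! ## §4 The assembly (v3): `EsymmLogTwistInsensitive` PROVED from the inputs of §3 / `FreeGasArcInputs` -/

/-- `∑_{j ∈ ℤ/Lℤ} g(j.val) = ∑_{j < L} g j`. -/
theorem sum_zmod_val_eq_sum_range (L : ℕ) [NeZero L] (g : ℕ → ℂ) :
    ∑ j : ZMod L, g j.val = ∑ j ∈ Finset.range L, g j := by
  obtain ⟨n, hn⟩ := Nat.exists_eq_succ_of_ne_zero (NeZero.ne L)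
  subst hn
  exact Fin.sum_univ_eq_sum_range g (n + 1)

/-- The one-line logarithm `v_{β,s,φ,p₂}(z) = Log(1 + exp(s + iφ + 2β cos z + 2β cos p₂))` (the `let v` of
`FreeGasArc.Inputs.FreeBandLogStrip`). -/
def lineLog (β s φ p₂ : ℝ) : ℂ → ℂ := fun z =>
  Complex.log (1 + Complex.exp ((s : ℂ) + (φ : ℂ) * Complex.I + 2 * β * Complex.cos z + 2 * β * Real.cos p₂))

/-- Each factor of the generating product is `1 + exp(s + iφ + 2β cos(p₁ − θ/L) + 2β cos p₂)`. -/
theorem freeWeight_factor (L : ℕ) (β θ s φ : ℝ) (k : TorusSite 2 L) :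
    (1 : ℂ) + ((Real.exp s * freeWeight L β θ k : ℝ) : ℂ) * Complex.exp (φ * Complex.I) =
      1 + Complex.exp ((s : ℂ) + (φ : ℂ) * Complex.I + 2 * β * Real.cos (latticeMomentum L k 0 - θ / L) +
        2 * β * Real.cos (latticeMomentum L k 1)) := by
  have hw : Real.exp s * freeWeight L β θ k =
      Real.exp (s + 2 * β * Real.cos (latticeMomentum L k 0 - θ / L) + 2 * β * Real.cos (latticeMomentum L k 1)) := by
    rw [freeWeight, ← Real.exp_add]
    congr 1
    simp [twistedBand, Fin.sum_univ_two]
    ring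
  rw [hw, Complex.ofReal_exp, ← Complex.exp_add]
  congr 2
  push_cast
  ring

/-- On the arc the generating product is `exp` of the sum of one-line logarithms. -/
theorem prod_factor_eq_exp_sum (L : ℕ) [NeZero L] (β θ s φ : ℝ)
    (hExp : ∀ p₂ p₁ : ℝ, Complex.exp (lineLog β s φ p₂ p₁) =
      1 + Complex.exp ((s : ℂ) + (φ : ℂ) * Complex.I + 2 * β * Real.cos p₁ + 2 * β * Real.cos p₂)) :
    ∏ k : TorusSite 2 L, ((1 : ℂ) + ((Real.exp s * freeWeight L β θ k : ℝ) : ℂ) * Complex.exp (φ * Complex.I)) =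
      Complex.exp (∑ k : TorusSite 2 L,
        lineLog β s φ (latticeMomentum L k 1) ((latticeMomentum L k 0 - θ / L : ℝ) : ℂ)) := by
  rw [Complex.exp_sum]
  refine Finset.prod_congr rfl fun k _ => ?_
  rw [freeWeight_factor, hExp]

/-- ARC STEP: the sum of one-line logarithms moves by at most `L · 4LB/(e^{aL} − 1)` under the twist
(`FreeGasArc.Inputs.shiftedTrapezoidShift_holds`, line by line in the transverse momentum). -/
theorem norm_lineSum_sub_le (L : ℕ) [NeZero L] (β θ s φ : ℝ) {a B : ℝ}
    (hST : FreeGasArc.Inputs.ShiftedTrapezoidShift) (ha : 0 < a) (hB : 0 ≤ B)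
    (hv : ∀ p₂ : ℝ, (∀ z : ℂ, lineLog β s φ p₂ (z + 2 * π) = lineLog β s φ p₂ z) ∧
      DifferentiableOn ℂ (lineLog β s φ p₂) {z : ℂ | |z.im| < a} ∧
      (∀ z : ℂ, |z.im| < a → ‖lineLog β s φ p₂ z‖ ≤ B)) :
    ‖∑ k : TorusSite 2 L, lineLog β s φ (latticeMomentum L k 1) ((latticeMomentum L k 0 - θ / L : ℝ) : ℂ) -
        ∑ k : TorusSite 2 L, lineLog β s φ (latticeMomentum L k 1) ((latticeMomentum L k 0 - 0 / L : ℝ) : ℂ)‖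
      ≤ L * (4 * L * B / (Real.exp (a * L) - 1)) := by
  have hL : 0 < L := Nat.pos_of_ne_zero (NeZero.ne L)
  have hre : ∀ θ' : ℝ, ∑ k : TorusSite 2 L,
      lineLog β s φ (latticeMomentum L k 1) ((latticeMomentum L k 0 - θ' / L : ℝ) : ℂ)
      = ∑ b : ZMod L, ∑ j ∈ Finset.range L,
          lineLog β s φ (2 * π * ((b.val : ℕ) : ℝ) / L) (((2 * π * (j : ℝ) + -θ') / (L : ℝ) : ℝ) : ℂ) := by
    intro θ'
    rw [← (piFinTwoEquiv fun _ : Fin 2 => ZMod L).symm.sum_comp, Fintype.sum_prod_type, Finset.sum_comm]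
    refine Finset.sum_congr rfl fun b _ => ?_
    rw [← sum_zmod_val_eq_sum_range L (fun j => lineLog β s φ (2 * π * ((b.val : ℕ) : ℝ) / L)
      (((2 * π * (j : ℝ) + -θ') / (L : ℝ) : ℝ) : ℂ))]
    refine Finset.sum_congr rfl fun j _ => ?_
    simp only [piFinTwoEquiv_symm_apply, Fin.cons_zero, Fin.cons_one, latticeMomentum]
    congr 1
    push_cast
    ring
  rw [hre θ, hre 0, ← Finset.sum_sub_distrib]
  calc ‖∑ b : ZMod L, (∑ j ∈ Finset.range L,
          lineLog β s φ (2 * π * ((b.val : ℕ) : ℝ) / L) (((2 * π * (j : ℝ) + -θ) / (L : ℝ) : ℝ) : ℂ) -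
        ∑ j ∈ Finset.range L,
          lineLog β s φ (2 * π * ((b.val : ℕ) : ℝ) / L) (((2 * π * (j : ℝ) + -0) / (L : ℝ) : ℝ) : ℂ))‖
      ≤ ∑ b : ZMod L, ‖∑ j ∈ Finset.range L,
          lineLog β s φ (2 * π * ((b.val : ℕ) : ℝ) / L) (((2 * π * (j : ℝ) + -θ) / (L : ℝ) : ℝ) : ℂ) -
        ∑ j ∈ Finset.range L,
          lineLog β s φ (2 * π * ((b.val : ℕ) : ℝ) / L) (((2 * π * (j : ℝ) + -0) / (L : ℝ) : ℝ) : ℂ)‖ :=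
        norm_sum_le _ _
    _ ≤ ∑ _b : ZMod L, 4 * L * B / (Real.exp (a * L) - 1) := Finset.sum_le_sum fun b _ => ?_
    _ = L * (4 * L * B / (Real.exp (a * L) - 1)) := by
        rw [Finset.sum_const, Finset.card_univ, ZMod.card, nsmul_eq_mul]
  obtain ⟨hper, hdiff, hbd⟩ := hv (2 * π * ((b.val : ℕ) : ℝ) / L)
  have h := hST (lineLog β s φ (2 * π * ((b.val : ℕ) : ℝ) / L)) a B ha hB hper hdiff hbd L hL (-θ)
  have h0 : ∑ j ∈ Finset.range L,
      lineLog β s φ (2 * π * ((b.val : ℕ) : ℝ) / L) (((2 * π * (j : ℝ) + -0) / (L : ℝ) : ℝ) : ℂ)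
      = ∑ j ∈ Finset.range L, lineLog β s φ (2 * π * ((b.val : ℕ) : ℝ) / L) (((2 * π * (j : ℝ)) / (L : ℝ) : ℝ) : ℂ) := by
    simp only [neg_zero, add_zero]
  rw [h0]
  exact h

/-- `‖∏_k (1 + u_k e^{iφ})‖ ≤ ∏_k (1 + u_k)` for the free weights. -/
theorem norm_prod_factor_le (L : ℕ) [NeZero L] (β θ s φ : ℝ) :
    ‖∏ k : TorusSite 2 L, ((1 : ℂ) + ((Real.exp s * freeWeight L β θ k : ℝ) : ℂ) * Complex.exp (φ * Complex.I))‖ ≤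
      ∏ k : TorusSite 2 L, (1 + Real.exp s * freeWeight L β θ k) := by
  rw [norm_prod]
  refine Finset.prod_le_prod (fun _ _ => norm_nonneg _) fun k _ => ?_
  have hu : 0 < Real.exp s * freeWeight L β θ k := mul_pos (Real.exp_pos _) (Real.exp_pos _)
  calc ‖(1 : ℂ) + ((Real.exp s * freeWeight L β θ k : ℝ) : ℂ) * Complex.exp (φ * Complex.I)‖
      ≤ ‖(1 : ℂ)‖ + ‖((Real.exp s * freeWeight L β θ k : ℝ) : ℂ) * Complex.exp (φ * Complex.I)‖ := norm_add_le _ _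
    _ = 1 + Real.exp s * freeWeight L β θ k := by
        rw [norm_one, norm_mul, Complex.norm_real, Complex.norm_exp_ofReal_mul_I, mul_one, Real.norm_eq_abs,
          abs_of_pos hu]

/-- POINTWISE CIRCLE BOUND: arc (trapezoid shift) + off-arc (Gaussian decay) give
`‖P_θ(φ) − P₀(φ)‖ ≤ ∏(1 + e^{s}w₀)·(2δ + 4e^{−cL²})` on the whole circle. -/
theorem pointwise_circle_bound (L : ℕ) [NeZero L] (β θ s : ℝ) {a B c δ : ℝ}
    (hST : FreeGasArc.Inputs.ShiftedTrapezoidShift) (hOA : FreeGasArc.Inputs.OffArcGaussianDecay)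
    (ha : 0 < a) (hB : 0 ≤ B)
    (hstripφ : ∀ φ' : ℝ, |φ'| ≤ π / 2 → ∀ p₂ : ℝ,
      (∀ z : ℂ, lineLog β s φ' p₂ (z + 2 * π) = lineLog β s φ' p₂ z) ∧
      DifferentiableOn ℂ (lineLog β s φ' p₂) {z : ℂ | |z.im| < a} ∧
      (∀ z : ℂ, |z.im| < a → ‖lineLog β s φ' p₂ z‖ ≤ B) ∧
      (∀ p₁ : ℝ, Complex.exp (lineLog β s φ' p₂ p₁) =
        1 + Complex.exp ((s : ℂ) + (φ' : ℂ) * Complex.I + 2 * β * Real.cos p₁ + 2 * β * Real.cos p₂)))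
    (hδ : (L : ℝ) * (4 * L * B / (Real.exp (a * L) - 1)) ≤ δ) (hδ0 : 0 ≤ δ) (hδ1 : δ ≤ 1)
    (hVθ : c * (L : ℝ) ^ 2 ≤ ∑ k : TorusSite 2 L,
      Real.exp s * freeWeight L β θ k / (1 + Real.exp s * freeWeight L β θ k) ^ 2)
    (hV0 : c * (L : ℝ) ^ 2 ≤ ∑ k : TorusSite 2 L,
      Real.exp s * freeWeight L β 0 k / (1 + Real.exp s * freeWeight L β 0 k) ^ 2) :
    ∀ φ : ℝ, φ ∈ Set.uIoc (-π) π →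
      ‖∏ k : TorusSite 2 L, ((1 : ℂ) + ((Real.exp s * freeWeight L β θ k : ℝ) : ℂ) * Complex.exp (φ * Complex.I)) -
          ∏ k : TorusSite 2 L, ((1 : ℂ) + ((Real.exp s * freeWeight L β 0 k : ℝ) : ℂ) * Complex.exp (φ * Complex.I))‖
        ≤ (∏ k : TorusSite 2 L, (1 + Real.exp s * freeWeight L β 0 k)) * (2 * δ + 4 * Real.exp (-(c * (L : ℝ) ^ 2))) := by
  intro φ hφ
  set P0 : ℝ := ∏ k : TorusSite 2 L, (1 + Real.exp s * freeWeight L β 0 k) with hP0def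
  set Pθ : ℝ := ∏ k : TorusSite 2 L, (1 + Real.exp s * freeWeight L β θ k) with hPθdef
  have hP0 : 0 ≤ P0 := Finset.prod_nonneg fun k _ => by unfold freeWeight; positivity
  have hPθ0 : 0 ≤ Pθ := Finset.prod_nonneg fun k _ => by unfold freeWeight; positivity
  -- arc closeness for every |φ'| ≤ π/2
  have harc : ∀ φ' : ℝ, |φ'| ≤ π / 2 →
      ‖∏ k : TorusSite 2 L, ((1 : ℂ) + ((Real.exp s * freeWeight L β θ k : ℝ) : ℂ) * Complex.exp (φ' * Complex.I)) -
          ∏ k : TorusSite 2 L, ((1 : ℂ) + ((Real.exp s * freeWeight L β 0 k : ℝ) : ℂ) * Complex.exp (φ' * Complex.I))‖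
        ≤ P0 * (2 * δ) := by
    intro φ' hφ'
    have hv := hstripφ φ' hφ'
    have hEθ := prod_factor_eq_exp_sum L β θ s φ' (fun p₂ p₁ => (hv p₂).2.2.2 p₁)
    have hE0 := prod_factor_eq_exp_sum L β 0 s φ' (fun p₂ p₁ => (hv p₂).2.2.2 p₁)
    have hS := norm_lineSum_sub_le L β θ s φ' hST ha hB (fun p₂ => ⟨(hv p₂).1, (hv p₂).2.1, (hv p₂).2.2.1⟩)
    set Sθ := ∑ k : TorusSite 2 L, lineLog β s φ' (latticeMomentum L k 1) ((latticeMomentum L k 0 - θ / L : ℝ) : ℂ)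
    set S0 := ∑ k : TorusSite 2 L, lineLog β s φ' (latticeMomentum L k 1) ((latticeMomentum L k 0 - 0 / L : ℝ) : ℂ)
    have hS1 : ‖Sθ - S0‖ ≤ 1 := (hS.trans hδ).trans hδ1
    have hn0 : ‖Complex.exp S0‖ ≤ P0 := by
      rw [← hE0]
      exact norm_prod_factor_le L β 0 s φ'
    rw [hEθ, hE0, show Complex.exp Sθ - Complex.exp S0 = Complex.exp S0 * (Complex.exp (Sθ - S0) - 1) by
      rw [mul_sub, mul_one, ← Complex.exp_add, add_sub_cancel], norm_mul]
    calc ‖Complex.exp S0‖ * ‖Complex.exp (Sθ - S0) - 1‖ ≤ P0 * (2 * ‖Sθ - S0‖) :=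
          mul_le_mul hn0 (Complex.norm_exp_sub_one_le hS1) (norm_nonneg _) hP0
      _ ≤ P0 * (2 * δ) := by gcongr; exact hS.trans hδ
  -- the twisted real product is at most `3 P0`
  have hPθ : Pθ ≤ 3 * P0 := by
    have h := harc 0 (by rw [abs_zero]; positivity)
    have hreal : ∀ θ' : ℝ, ∏ k : TorusSite 2 L, ((1 : ℂ) + ((Real.exp s * freeWeight L β θ' k : ℝ) : ℂ) *
        Complex.exp ((0 : ℝ) * Complex.I)) = ((∏ k : TorusSite 2 L, (1 + Real.exp s * freeWeight L β θ' k) : ℝ) : ℂ) := by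
      intro θ'
      push_cast
      refine Finset.prod_congr rfl fun k _ => ?_
      simp
    rw [hreal θ, hreal 0, ← Complex.ofReal_sub, Complex.norm_real, Real.norm_eq_abs] at h
    have := (abs_le.1 h).2
    nlinarith [hδ1, hP0]
  by_cases hφa : |φ| ≤ π / 2
  · calc _ ≤ P0 * (2 * δ) := harc φ hφa
      _ ≤ P0 * (2 * δ + 4 * Real.exp (-(c * (L : ℝ) ^ 2))) := by
          gcongr
          linarith [Real.exp_pos (-(c * (L : ℝ) ^ 2))]
  · -- off the arc: `cos φ ≤ 0`
    rw [Set.uIoc_of_le (by linarith [Real.pi_pos]), Set.mem_Ioc] at hφ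
    have hcos : Real.cos φ ≤ 0 := by
      rw [← Real.cos_abs]
      have h1 : π / 2 < |φ| := lt_of_not_ge hφa
      have h2 : |φ| ≤ π := abs_le.2 ⟨by linarith [hφ.1], hφ.2⟩
      exact Real.cos_nonpos_of_pi_div_two_le_of_le h1.le (by linarith [Real.pi_pos])
    have hoff : ∀ θ' : ℝ, c * (L : ℝ) ^ 2 ≤ ∑ k : TorusSite 2 L,
        Real.exp s * freeWeight L β θ' k / (1 + Real.exp s * freeWeight L β θ' k) ^ 2 →
        ‖∏ k : TorusSite 2 L, ((1 : ℂ) + ((Real.exp s * freeWeight L β θ' k : ℝ) : ℂ) * Complex.exp (φ * Complex.I))‖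
          ≤ (∏ k : TorusSite 2 L, (1 + Real.exp s * freeWeight L β θ' k)) * Real.exp (-(c * (L : ℝ) ^ 2)) := by
      intro θ' hV
      have h := hOA (TorusSite 2 L) (fun k => Real.exp s * freeWeight L β θ' k) φ
        (fun k => mul_pos (Real.exp_pos _) (Real.exp_pos _))
      beta_reduce at h
      rw [mul_comm Complex.I (φ : ℂ)] at h
      refine h.trans (mul_le_mul_of_nonneg_left (Real.exp_le_exp.2 ?_)
        (Finset.prod_nonneg fun k _ => by unfold freeWeight; positivity))
      have hVnn : 0 ≤ ∑ k : TorusSite 2 L,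
          Real.exp s * freeWeight L β θ' k / (1 + Real.exp s * freeWeight L β θ' k) ^ 2 :=
        Finset.sum_nonneg fun k _ => by unfold freeWeight; positivity
      nlinarith [hcos, hV, hVnn, mul_nonneg (neg_nonneg.2 hcos) hVnn]
    calc _ ≤ ‖∏ k : TorusSite 2 L, ((1 : ℂ) + ((Real.exp s * freeWeight L β θ k : ℝ) : ℂ) * Complex.exp (φ * Complex.I))‖ +
          ‖∏ k : TorusSite 2 L, ((1 : ℂ) + ((Real.exp s * freeWeight L β 0 k : ℝ) : ℂ) * Complex.exp (φ * Complex.I))‖ :=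
          norm_sub_le _ _
      _ ≤ Pθ * Real.exp (-(c * (L : ℝ) ^ 2)) + P0 * Real.exp (-(c * (L : ℝ) ^ 2)) :=
          add_le_add (hoff θ hVθ) (hoff 0 hV0)
      _ ≤ 3 * P0 * Real.exp (-(c * (L : ℝ) ^ 2)) + P0 * Real.exp (-(c * (L : ℝ) ^ 2)) := by
          gcongr
      _ = P0 * (4 * Real.exp (-(c * (L : ℝ) ^ 2))) := by ring
      _ ≤ P0 * (2 * δ + 4 * Real.exp (-(c * (L : ℝ) ^ 2))) := by
          gcongr
          linarith

/-- Arithmetic of the sector: `1 ≤ M < L²`, `M + 1 ≤ e(L² − M)`, `L² − M + 1 ≤ e M` for `M = ⌊7L²/16⌋`, `L ≥ 3`. -/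
theorem halfCount_bounds {L : ℕ} (hL : 3 ≤ L) :
    1 ≤ halfCount L ∧ halfCount L < L ^ 2 ∧
      ((halfCount L : ℝ) + 1) ≤ Real.exp 1 * ((L : ℝ) ^ 2 - halfCount L) ∧
      ((L : ℝ) ^ 2 - halfCount L + 1) ≤ Real.exp 1 * halfCount L := by
  have hL' : (3 : ℝ) ≤ L := by exact_mod_cast hL
  have hn : (9 : ℝ) ≤ (L : ℝ) ^ 2 := by nlinarith
  have h78 : (1 - (1 - 7 / 8 : ℝ)) * (L : ℝ) ^ 2 / 2 = 7 * (L : ℝ) ^ 2 / 16 := by ring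
  have hfl : (halfCount L : ℝ) ≤ 7 * (L : ℝ) ^ 2 / 16 := by
    rw [halfCount, ← h78]
    exact Nat.floor_le (by positivity)
  have hfl2 : 7 * (L : ℝ) ^ 2 / 16 < (halfCount L : ℝ) + 1 := by
    rw [halfCount, ← h78]
    exact_mod_cast Nat.lt_floor_add_one _
  have he : (2.7 : ℝ) < Real.exp 1 := lt_trans (by norm_num) Real.exp_one_gt_d9
  refine ⟨?_, ?_, ?_, ?_⟩
  · have : (1 : ℝ) ≤ halfCount L := by linarith
    exact_mod_cast this
  · have : (halfCount L : ℝ) < (L : ℝ) ^ 2 := by nlinarith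
    exact_mod_cast this
  · have hD : 0 ≤ (L : ℝ) ^ 2 - halfCount L := by linarith
    nlinarith [mul_le_mul_of_nonneg_right he.le hD]
  · have hM0 : 0 ≤ (halfCount L : ℝ) := by positivity
    nlinarith [mul_le_mul_of_nonneg_right he.le hM0]

/-- The rate `ε_L = 128 B L⁴ e^{−aL} + 32 L² e^{−cL²}` tends to `0`. -/
theorem rate_tendsto {a c : ℝ} (B : ℝ) (ha : 0 < a) (hc : 0 < c) :
    Tendsto (fun L : ℕ => 128 * B * (L : ℝ) ^ 4 * Real.exp (-(a * L)) +
      32 * (L : ℝ) ^ 2 * Real.exp (-(c * (L : ℝ) ^ 2))) atTop (𝓝 0) := by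
  have h1 : Tendsto (fun L : ℕ => a * (L : ℝ)) atTop atTop := tendsto_natCast_atTop_atTop.const_mul_atTop ha
  have h2 : Tendsto (fun L : ℕ => c * (L : ℝ) ^ 2) atTop atTop :=
    ((tendsto_pow_atTop two_ne_zero).comp tendsto_natCast_atTop_atTop).const_mul_atTop hc
  have h3 := (Real.tendsto_pow_mul_exp_neg_atTop_nhds_zero 4).comp h1
  have h4 := (Real.tendsto_pow_mul_exp_neg_atTop_nhds_zero 1).comp h2
  have h5 := (h3.const_mul (128 * B / a ^ 4)).add (h4.const_mul (32 / c))
  simp only [mul_zero, add_zero] at h5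
  refine h5.congr' (Filter.Eventually.of_forall fun L => ?_)
  simp only [Function.comp]
  field_simp

/-- The fugacity window: the pinning inequalities at `M = ⌊7L²/16⌋`, `L ≥ 3`, force `|log t| ≤ 4β + 1`. -/
theorem fugacity_window {β t : ℝ} {L : ℕ} (hβ : 0 < β) (ht : 0 < t) (hL3 : 3 ≤ L)
    (hp1 : ((L : ℝ) ^ 2 - halfCount L) * Real.exp (-(4 * β)) * t ≤ (halfCount L : ℝ) + 1)
    (hp2 : (halfCount L : ℝ) ≤ ((L : ℝ) ^ 2 - halfCount L + 1) * Real.exp (4 * β) * t) :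
    -4 * β - 1 ≤ Real.log t ∧ Real.log t ≤ 4 * β + 1 := by
  obtain ⟨hM1, hMn, hpin1, hpin2⟩ := halfCount_bounds hL3
  have hD : 0 < (L : ℝ) ^ 2 - halfCount L := by
    have : (halfCount L : ℝ) < (L : ℝ) ^ 2 := by exact_mod_cast (show halfCount L < L ^ 2 from hMn)
    linarith
  have hMpos : 0 < (halfCount L : ℝ) := by exact_mod_cast hM1
  have _hβ := hβ
  constructor
  · rw [Real.le_log_iff_exp_le ht]
    have h0 : (0 : ℝ) ≤ Real.exp (4 * β) * t := by positivity
    have h1 : (halfCount L : ℝ) * 1 ≤ (halfCount L : ℝ) * (Real.exp 1 * Real.exp (4 * β) * t) := by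
      have := mul_le_mul_of_nonneg_right hpin2 h0
      nlinarith
    have h2 : 1 ≤ Real.exp 1 * Real.exp (4 * β) * t := le_of_mul_le_mul_left h1 hMpos
    have h3 : Real.exp (-4 * β - 1) * (Real.exp 1 * Real.exp (4 * β)) = 1 := by
      rw [← Real.exp_add, ← Real.exp_add, show -4 * β - 1 + (1 + 4 * β) = 0 by ring, Real.exp_zero]
    calc Real.exp (-4 * β - 1) = Real.exp (-4 * β - 1) * 1 := (mul_one _).symm
      _ ≤ Real.exp (-4 * β - 1) * (Real.exp 1 * Real.exp (4 * β) * t) :=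
          mul_le_mul_of_nonneg_left h2 (Real.exp_pos _).le
      _ = t := by
          rw [show Real.exp 1 * Real.exp (4 * β) * t = (Real.exp 1 * Real.exp (4 * β)) * t by ring,
            ← mul_assoc, h3, one_mul]
  · rw [Real.log_le_iff_le_exp ht]
    have h1 : ((L : ℝ) ^ 2 - halfCount L) * (Real.exp (-(4 * β)) * t) ≤
        ((L : ℝ) ^ 2 - halfCount L) * Real.exp 1 := by nlinarith
    have h2 : Real.exp (-(4 * β)) * t ≤ Real.exp 1 := le_of_mul_le_mul_left h1 hD
    have h3 : t = Real.exp (4 * β) * (Real.exp (-(4 * β)) * t) := by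
      rw [← mul_assoc, ← Real.exp_add]
      simp
    rw [h3, Real.exp_add]
    exact mul_le_mul_of_nonneg_left h2 (Real.exp_pos _).le

/-- The arc error `δ_L = L · 4LB/(e^{aL} − 1)` is nonnegative and `8(L² + 1)δ_L ≤ 128 B L⁴ e^{−aL}` once `aL ≥ 1`. -/
theorem delta_bound {a B : ℝ} {L : ℕ} (hB : 0 ≤ B) (haL : 1 ≤ a * L) (hL1 : (1 : ℝ) ≤ L) :
    0 ≤ (L : ℝ) * (4 * L * B / (Real.exp (a * L) - 1)) ∧
      8 * ((L : ℝ) ^ 2 + 1) * ((L : ℝ) * (4 * L * B / (Real.exp (a * L) - 1))) ≤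
        128 * B * (L : ℝ) ^ 4 * Real.exp (-(a * L)) := by
  have hexp2 : 2 ≤ Real.exp (a * L) := by
    have := Real.exp_le_exp.2 haL
    have he : (2 : ℝ) < Real.exp 1 := lt_trans (by norm_num) Real.exp_one_gt_d9
    linarith
  have hden : 0 < Real.exp (a * L) - 1 := by linarith
  have hL0 : (0 : ℝ) ≤ L := by linarith
  refine ⟨by positivity, ?_⟩
  have hinv : 1 / (Real.exp (a * L) - 1) ≤ 2 * Real.exp (-(a * L)) := by
    rw [div_le_iff₀ hden, Real.exp_neg]
    have hpos : 0 < Real.exp (a * L) := Real.exp_pos _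
    have hin : (Real.exp (a * L))⁻¹ * Real.exp (a * L) = 1 := inv_mul_cancel₀ hpos.ne'
    nlinarith [hin, hexp2, inv_pos.2 hpos, mul_le_mul_of_nonneg_left hexp2 (inv_pos.2 hpos).le]
  have hL21 : (L : ℝ) ^ 2 + 1 ≤ 2 * (L : ℝ) ^ 2 := by nlinarith
  have hδ' : (L : ℝ) * (4 * L * B / (Real.exp (a * L) - 1)) =
      4 * (L : ℝ) ^ 2 * B * (1 / (Real.exp (a * L) - 1)) := by
    field_simp
  rw [hδ']
  calc 8 * ((L : ℝ) ^ 2 + 1) * (4 * (L : ℝ) ^ 2 * B * (1 / (Real.exp (a * L) - 1)))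
      ≤ 8 * (2 * (L : ℝ) ^ 2) * (4 * (L : ℝ) ^ 2 * B * (2 * Real.exp (-(a * L)))) := by gcongr
    _ = 128 * B * (L : ℝ) ^ 4 * Real.exp (-(a * L)) := by ring

/-- **STUB 2 IS A THEOREM (v3).** The analytic core `EsymmLogTwistInsensitive` holds: proved from the generic inputs
of `FreeGasArcInputs` (contour formula, mode fugacity + polynomial floor + pinning, arc trapezoid shift, strip
analyticity, off-arc Gaussian decay, ratio-to-log step) and the model-specific `freeBandOccupationVariance`, with
`θ₁ = π` and `ε_L = 128 B L⁴ e^{−aL} + 32 L² e^{−cL²}`. -/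
theorem esymmLogTwistInsensitive_holds : EsymmLogTwistInsensitive := by
  intro β hβ
  obtain ⟨a, ha, B, hB, hstrip⟩ := FreeGasArc.Inputs.freeBandLogStrip_holds β hβ
  obtain ⟨c, hc, L₁, hvar⟩ := freeBandOccupationVariance β hβ
  -- the rate function and the threshold
  have hε_tendsto := rate_tendsto B ha hc
  obtain ⟨L₂, hL₂⟩ := Filter.eventually_atTop.1 (hε_tendsto.eventually (eventually_lt_nhds zero_lt_one))
  refine ⟨π, Real.pi_pos, _, hε_tendsto, max (max L₁ L₂) (max 3 (⌈1 / a⌉₊ + 1)), ?_⟩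
  intro L _ hL θ hθ
  have hL1 : L₁ ≤ L := le_trans (le_max_left _ _) (le_trans (le_max_left _ _) hL)
  have hL2 : L₂ ≤ L := le_trans (le_max_right _ _) (le_trans (le_max_left _ _) hL)
  have hL3 : 3 ≤ L := le_trans (le_max_left _ _) (le_trans (le_max_right _ _) hL)
  have hLa : ⌈1 / a⌉₊ + 1 ≤ L := le_trans (le_max_right _ _) (le_trans (le_max_right _ _) hL)
  have hL1' : (1 : ℝ) ≤ L := by exact_mod_cast le_trans (by norm_num) hL3
  have haL : 1 ≤ a * L := by
    have h1 : (1 / a : ℝ) ≤ ⌈1 / a⌉₊ := Nat.le_ceil _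
    have h2 : ((⌈1 / a⌉₊ + 1 : ℕ) : ℝ) ≤ L := by exact_mod_cast hLa
    push_cast at h2
    have h3 : 1 / a < L := by linarith
    rw [div_lt_iff₀ ha] at h3
    linarith
  -- weights: positivity and the band window `[e^{−4β}, e^{4β}]`
  have hwpos : ∀ (θ' : ℝ) (k : TorusSite 2 L), 0 < freeWeight L β θ' k := fun _ _ => Real.exp_pos _
  have hwb : ∀ (θ' : ℝ) (k : TorusSite 2 L), Real.exp (-(4 * β)) ≤ freeWeight L β θ' k := by
    intro θ' k
    have hξ := abs_le.1 (abs_twistedBand_le L θ' k)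
    exact Real.exp_le_exp.2 (by nlinarith [hξ.1, hξ.2, hβ])
  have hwB : ∀ (θ' : ℝ) (k : TorusSite 2 L), freeWeight L β θ' k ≤ Real.exp (4 * β) := by
    intro θ' k
    have hξ := abs_le.1 (abs_twistedBand_le L θ' k)
    exact Real.exp_le_exp.2 (by nlinarith [hξ.1, hξ.2, hβ])
  have hcardN : Fintype.card (TorusSite 2 L) = L ^ 2 := by
    rw [Fintype.card_fun, ZMod.card, Fintype.card_fin]
  have hcard : (Fintype.card (TorusSite 2 L) : ℝ) = (L : ℝ) ^ 2 := by
    rw [hcardN]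
    push_cast
    ring
  obtain ⟨hM1, hMn, -, -⟩ := halfCount_bounds hL3
  -- the mode fugacity of the untwisted weights, pinned to the window
  obtain ⟨t, ht, hmode, -, hp1, hp2⟩ := FreeGasArc.Inputs.exists_modeFugacity_pinned (freeWeight L β 0)
    (Real.exp_pos (-(4 * β))) (hwb 0) (hwB 0) hM1 (by rw [hcardN]; exact hMn)
  rw [hcard] at hp1 hp2
  obtain ⟨hs1, hs2⟩ := fugacity_window hβ ht hL3 hp1 hp2
  have hts : Real.exp (Real.log t) = t := Real.exp_log ht
  -- δ, K and their smallness
  obtain ⟨hδ0, hδ_le⟩ := delta_bound (a := a) hB haL hL1'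
  have hK2_le : 16 * ((L : ℝ) ^ 2 + 1) * Real.exp (-(c * (L : ℝ) ^ 2)) ≤
      32 * (L : ℝ) ^ 2 * Real.exp (-(c * (L : ℝ) ^ 2)) := by
    have hL21 : 16 * ((L : ℝ) ^ 2 + 1) ≤ 32 * (L : ℝ) ^ 2 := by nlinarith [hL1']
    exact mul_le_mul_of_nonneg_right hL21 (Real.exp_pos (-(c * (L : ℝ) ^ 2))).le
  have hεL := hL₂ L hL2
  have h16 : 0 ≤ 16 * ((L : ℝ) ^ 2 + 1) * Real.exp (-(c * (L : ℝ) ^ 2)) := by positivity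
  have h8 : (L : ℝ) * (4 * L * B / (Real.exp (a * L) - 1)) ≤
      8 * ((L : ℝ) ^ 2 + 1) * ((L : ℝ) * (4 * L * B / (Real.exp (a * L) - 1))) := by
    nlinarith [mul_nonneg hδ0 (sq_nonneg (L : ℝ))]
  have hδ1 : (L : ℝ) * (4 * L * B / (Real.exp (a * L) - 1)) ≤ 1 := by linarith
  have hK0 : 0 ≤ 2 * ((L : ℝ) * (4 * L * B / (Real.exp (a * L) - 1))) + 4 * Real.exp (-(c * (L : ℝ) ^ 2)) := by
    positivity
  have hsmall : (((Fintype.card (TorusSite 2 L) : ℝ)) + 1) *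
      (2 * ((L : ℝ) * (4 * L * B / (Real.exp (a * L) - 1))) + 4 * Real.exp (-(c * (L : ℝ) ^ 2))) ≤ 1 / 2 := by
    rw [hcard]
    linarith
  -- strip facts at `s = log t`
  have hstripφ : ∀ φ' : ℝ, |φ'| ≤ π / 2 → ∀ p₂ : ℝ,
      (∀ z : ℂ, lineLog β (Real.log t) φ' p₂ (z + 2 * π) = lineLog β (Real.log t) φ' p₂ z) ∧
      DifferentiableOn ℂ (lineLog β (Real.log t) φ' p₂) {z : ℂ | |z.im| < a} ∧
      (∀ z : ℂ, |z.im| < a → ‖lineLog β (Real.log t) φ' p₂ z‖ ≤ B) ∧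
      (∀ p₁ : ℝ, Complex.exp (lineLog β (Real.log t) φ' p₂ p₁) =
        1 + Complex.exp (((Real.log t : ℝ) : ℂ) + (φ' : ℂ) * Complex.I + 2 * β * Real.cos p₁ + 2 * β * Real.cos p₂)) :=
    fun φ' hφ' p₂ => hstrip (Real.log t) hs1 hs2 φ' hφ' p₂
  -- the pointwise circle bound
  have hpt := pointwise_circle_bound L β θ (Real.log t) FreeGasArc.Inputs.shiftedTrapezoidShift_holds
    FreeGasArc.Inputs.offArcGaussianDecay_holds ha hB hstripφ le_rfl hδ0 hδ1
    (hvar L hL1 θ hθ (Real.log t) hs1 hs2) (hvar L hL1 0 (by rw [abs_zero]; positivity) (Real.log t) hs1 hs2)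
  rw [hts] at hpt
  -- the ratio-to-log step
  have hmain := FreeGasArc.Inputs.abs_log_esymmW_sub_le (freeWeight L β θ) (freeWeight L β 0) (hwpos θ) (hwpos 0)
    ht (M := halfCount L) (by rw [hcardN]; exact hMn.le) hmode hK0 hpt hsmall
  rw [hcard] at hmain
  simp only [esymmW_eq_inputs]
  rw [← mul_sub, abs_mul, abs_two]
  linarith

/-! ## §5 Final compositions (v4: UNCONDITIONAL — stub 1 is proved in §6, stub 2 in §4) -/

/-- **The rung (unconditional since v4):** `ObsThermalStiffnessSeqCeilingAtBeta 0 0 (7/8) β 0` for every `β > 0`. -/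
theorem freeGas_rung {β : ℝ} (hβ : 0 < β) : ObsThermalStiffnessSeqCeilingAtBeta 0 0 (7 / 8) β 0 :=
  freeGas_rung_of sectorLogZFreeFactorisation_of_stub esymmLogTwistInsensitive_holds hβ

/-- **K1's literal `U = 0` twin (unconditional since v4):** `ObsThermalStiffnessSeqCeilingAtBeta 0 0 (7/8) 10 (1/8)`. -/
theorem freeGas_K1twin : ObsThermalStiffnessSeqCeilingAtBeta 0 0 (7 / 8) 10 (1 / 8) :=
  freeGas_K1twin_of' sectorLogZFreeFactorisation_of_stub esymmLogTwistInsensitive_holds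

/-- The card's witness statement (unconditional since v4). -/
theorem freeGasSectorTwistInsensitive_of_stub : FreeGasSectorTwistInsensitive 0 (7 / 8) :=
  freeGasSectorTwistInsensitive_of sectorLogZFreeFactorisation_of_stub esymmLogTwistInsensitive_holds

end Summit.Ventures.CertifiedManyBodySolver.Cruxes.ThermalStiffnessCeilingU8b10_le_1o8.FreeGasArc
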